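import Summits.HubbardSuperconductivity.HubbardSuperconductivity.Theses.ChiralWindow
import Literature.Barriers.HubbardSuperconductivity.PureModelStripeCompetitionProofs
import Literature.MathematicalPhysics.QuantumLattice.DWaveSourceFreePressure
import Summits.HubbardSuperconductivity.HubbardSuperconductivity.Theorems.SsbToEvenTorusLro.Negative.MatrixClausesAndBox
import Summits.HubbardSuperconductivity.HubbardSuperconductivity.Theorems.WcbcsSsbToTorusLRO.Negative.SummitMatrixUniformFloor
import Literature.MathematicalPhysics.QuantumLattice.PatchPairOperator
import Literature.MathematicalPhysics.QuantumLattice.DWaveSourceFreeGainBound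
import Literature.MathematicalPhysics.QuantumLattice.HubbardFreeCovariance
import Literature.MathematicalPhysics.QuantumLattice.FinDimSpectrumSectorGibbsLimit
import Literature.MathematicalPhysics.QuantumLattice.DopedRVBState
import Literature.MathematicalPhysics.QuantumLattice.PairedProductStates
import Summits.HubbardSuperconductivity.HubbardSuperconductivity.Theorems.ThermalWedgeTwTipContinuationEdgeOrderPairAlgebra

/-!
# Disproof of `CwThesis` (item `stmt-HubbardSuperconductivity-10438`, route ChiralWindow) — findings

Standing disprover's workfile (cdisprove, generation 1, cycle 1; §6 completed in the same cycle). The crux is the route TARGET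

  `CwThesis : ∃ U₀ > 0, ∀ U ∈ (0,U₀), ∃ δ ∈ [3/10, 12/25], HasDWavePairFieldLROAt U δ`

(the summit's matrix at `(U, δ)` inlined; `cwThesis_iff` is `Iff.rfl`). It is summit-strength: any
disproof must exhibit, for arbitrarily small repulsion `U > 0` and EVERY doping of the window, a
normalised even-torus `(N_L, S^z = 0)`-sector ground-state sequence of the pure Hubbard model without
`d_{x²-y²}` pair-field long-range order (`not_cwThesis_iff_exists_orderPoor`) — i.e. a proof of absence of
`d`-wave superconductivity at weak coupling throughout `n ∈ [0.52, 0.70]`, which is open (no rigorous result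
excludes `T = 0` pair LRO at small `U > 0`; Simkovic et al. 2016, arXiv:1512.04271 p. 8, put the leading `U → 0`
Kohn–Luttinger instability at `t' = 0` in the `d_{x²-y²}` channel for a wide region around half filling
reaching `n ≈ 0.65-0.7`, i.e. the LOWER edge `δ = 3/10` of the window, with `p⁽⁶⁾` at `n ≈ 0.6` and `d_xy` for
`n < 0.55`). NO KILL. What this file records (everything is `sorry`-free; axioms propext/choice/Quot.sound):

§0 `cwThesis_iff` — bridge to the barrier-catalogue matrix `HasDWavePairFieldLROAt` (by `Iff.rfl`), so that
   every tree lemma on the summit matrix applies verbatim.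
§1 ARMOUR: `not_cwThesis_iff`, `not_cwThesis_iff_exists_orderPoor`, `cwThesis_iff_eventually`
   (`X ↔ ∀ᶠ U in 𝓝[>] 0, ∃ δ ∈ window, matrix`; so `X` is monotone in `U₀` and a refutation must work
   FREQUENTLY as `U → 0⁺`).
§2 QUANTIFIER ORDER: `cwThesis_of_exists_forall` (a WcbcsThesis-shaped `∃ δ ∈ window ∃ U₀ ∀ U` statement
   implies `X`) and `forallExists_not_imp_existsForall` (abstractly the converse fails: `δ_U` may drift
   with `U`, which is exactly the route's point — the crossing line `δ*(U)`).
§3 LOAD-BEARING CLAUSES in thesis shape (from the tree's `not_matrix_without_*`, crux SsbToEvenTorusLro):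
   `cwThesis_false_without_groundStateClause`, `cwThesis_false_without_normalisation`,
   `cwThesis_false_without_numberClause` — each admissibility clause of the matrix is used by any proof.
§4 THE WINDOW'S EDGES: `hasDWavePairFieldLROAt_of_le_neg_three_halves` — for `δ ≤ -3/2` the matrix is
   VACUOUSLY TRUE (the prescribed `N_2 = 2⌊2(1-δ)⌋ ≥ 10` electrons do not fit on the `2 × 2` torus, 8
   orbitals), hence `cwThesisWithoutWindow_trivial`: with the window dropped (`∃ δ : ℝ`) the thesis is
   TRIVIALLY PROVABLE — the lower window edge is anti-vacuity armour, not only physics; and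
   `not_hasDWavePairFieldLROAt_of_one_le` — for `δ ≥ 1` (empty band) the matrix is FALSE at every `U`
   (ground states of the `(0,0)` sector are multiples of the vacuum), hence `cwThesisAtEmptyBand_false`.
   So a window inside `(-1, 1)` is forced on both sides by bookkeeping alone; `[3/10, 12/25] ⊂ (0, 1/2)` is
   what `Assembly` needs.
§5 NORMAL FORM: `cwThesis_iff_floor` — `X` is equivalent to a floor `a(U, δ_U) > 0` on the pair intensity
   `re⟨ψ, P†P ψ⟩ ≥ a L⁴`, UNIFORM over the whole ground space of the sector at every large even side
   (tree `hasDWavePairFieldLROAt_iff_floor`, crux WcbcsSsbToTorusLRO). This is where "every ground state"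
   (Koma–Tasaki 1994 Conjecture 10, crux CwSsbToEvenTorusLRO) bites: one order-poor ground state per large
   even `L` at every `δ` of the window refutes `X` at that `U`.
§6 THE `U = 0` ENDPOINT (`0 < U` is load-bearing; PROVED): `not_hasDWavePairFieldLROAt_zero_of_freeBound` and
   `cwThesis_false_from_zero_of_freeBound` — IF every normalised sector ground state of the FREE torus
   (`hubbardTorus 2 L 1 0`, `L ≥ 3`) has pair intensity `≤ C·L²`, then the matrix fails at `U = 0` for every
   `δ ≥ 0` and the variant of `X` with `U ∈ [0, U₀)` is false. The free bound itself,
   `FreeEndpoint.free_pairIntensity_le` (constant `C = 320`), is PROVED in §6 (sub-namespace `FreeEndpoint`,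
   Parts I–IV, sorry-free, axioms {propext, Classical.choice, Quot.sound}; landing as
   `Theorems/CwThesis/Negative/FreeEndpoint.lean`): aufbau by the operator inequality
   `H₀ - μN ≥ Σ_{kσ} min(ε_k - μ, 0)` saturated on the pair-filled aufbau vector, filled/empty Bloch modes off
   the Fermi level for EVERY sector ground state (paired-product-state calculus of `PairedProductStates.lean`), the level-set bound `#{k : ε_L(k) = μ} ≤ 2L`, and the
   hard-core pair algebra of `ReducedBCSTorus`. Hence UNCONDITIONALLY: `not_hasDWavePairFieldLROAt_zero`
   (the matrix fails at `U = 0` for every `δ ≥ 0`) and `cwThesis_false_from_zero`. Consequence for provers: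
   the order constant `a(U, δ_U)` of §5 must degenerate as `U → 0⁺` (no proof can be uniform down to
   `U = 0`), consistent with the `exp(-C/U²)` scale of `CwChiralConstruction`; and any weak-coupling
   construction must beat the free aufbau structure (sharp Fermi step ⇒ pair intensity `O(L²)`).

§7 NO `U`-UNIFORM CONSTANTS (PROVED): `cwThesis_false_uniformFloor` — the strengthening of `X` in which the floor
   constant `a` AND the finite-size threshold `k₀` are uniform in `U ∈ (0, U₀)` (the doping `δ_U` still free to
   drift) is FALSE: at a fixed large even side, ground states along `U_j → 0` accumulate at a FREE ground state of
   a repeating sector (compact unit sphere + pigeonhole; `UniformFloor.no_floor_along_vanishing_couplings`,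
   sector energies converge since `H(U) = H(0) + U·Σ n↑n↓`), contradicting §6. `X` is this statement with
   `a, k₀` depending on `U` (`cwThesis_iff_floor`), so the constants of any proof must degenerate as `U → 0⁺`.

Dead ends (one line each): no decidable/small-model instance (the matrix is a `liminf` over `L → ∞`);
Nagaoka/flat-band ferromagnetism (route NoGo's singlet-pair kill) needs `U → ∞`, outside `(0, U₀)`;
Koma–Tasaki / Hohenberg–Mermin–Wagner pairing bounds are `T > 0` statements; Bach–Lieb–Solovej
(generalised HF has no pairing for `U > 0`, barrier `GeneralizedHartreeFockNoPairing`) constrains a METHOD,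
not the ground state; the strong-coupling stripe no-go `PureModelStripeCompetition` sits at `(8, 1/8)`.

Sources: Koma–Tasaki, J. Stat. Phys. 76 (1994) 745; Scalapino, Phys. Rep. 250 (1995) 329 §2; Lieb, PRL 62
(1989) 1201; Šimkovic–Deng–Kozik–Prokof'ev–Svistunov–… PRB 94 (2016) 085106 = arXiv:1512.04271 pp. 8-10;
Raghu–Kivelson–Scalapino PRB 81 (2010) 224505.
-/

noncomputable section

set_option linter.dupNamespace false

/-! ## Appendix (placed first for scoping): the free endpoint, proved — Parts I–IV, to land verbatim as
`Theorems/CwThesis/Negative/FreeEndpoint.lean` (namespace there: `Summit.HubbardSuperconductivity.CwThesis.Negative`) -/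

namespace Summit.HubbardSuperconductivity.HubbardSuperconductivity.Cruxes.CwThesis.Disproof.FreeEndpoint

open Matrix Finset Real Literature.MathematicalPhysics.QuantumLattice Literature.Probability.LatticeModels
open scoped ComplexOrder ComplexConjugate

open Matrix Finset Real Literature.MathematicalPhysics.QuantumLattice Literature.Probability.LatticeModels
open scoped ComplexOrder ComplexConjugate

/-! ## Part I. Level sets of the square-lattice band are thin -/

section LevelSet

variable {L : ℕ} [NeZero L]

/-- Two residues with the same cosine of the lattice angle are equal or opposite:
`cos(2πa/L) = cos(2πb/L) → b = a ∨ b = -a` in `ℤ/Lℤ`. [folklore] -/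
theorem zmod_eq_or_eq_neg_of_cos_eq {a b : ZMod L}
    (h : Real.cos (2 * π * (a.val : ℝ) / L) = Real.cos (2 * π * (b.val : ℝ) / L)) :
    b = a ∨ b = -a := by
  have hLpos : (0:ℝ) < L := by exact_mod_cast Nat.pos_of_ne_zero (NeZero.ne L)
  have hq : (2 * π / (L:ℝ)) ≠ 0 := (div_pos (by positivity) hLpos).ne'
  rw [Real.cos_eq_cos_iff] at h
  obtain ⟨m, hm | hm⟩ := h
  · left
    have e1 : 2 * π * (b.val : ℝ) / L = (2 * π / L) * b.val := by ring
    have e2 : 2 * (m : ℝ) * π + 2 * π * (a.val : ℝ) / L = (2 * π / L) * (m * L + a.val) := by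
      field_simp
    rw [e1, e2] at hm
    have h1 : (b.val : ℝ) = m * L + a.val := mul_left_cancel₀ hq hm
    have h2 : ((b.val : ℕ) : ℤ) = m * L + (a.val : ℕ) := by exact_mod_cast h1
    have h3 := congrArg (fun z : ℤ => (z : ZMod L)) h2
    simp only [Int.cast_natCast, ZMod.natCast_zmod_val, Int.cast_add, Int.cast_mul, ZMod.natCast_self,
      mul_zero, zero_add] at h3
    exact h3
  · right
    have e1 : 2 * π * (b.val : ℝ) / L = (2 * π / L) * b.val := by ring
    have e2 : 2 * (m : ℝ) * π - 2 * π * (a.val : ℝ) / L = (2 * π / L) * (m * L - a.val) := by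
      field_simp
    rw [e1, e2] at hm
    have h1 : (b.val : ℝ) = m * L - a.val := mul_left_cancel₀ hq hm
    have h2 : ((b.val : ℕ) : ℤ) = m * L - (a.val : ℕ) := by exact_mod_cast h1
    have h3 := congrArg (fun z : ℤ => (z : ZMod L)) h2
    simp only [Int.cast_natCast, ZMod.natCast_zmod_val, Int.cast_sub, Int.cast_mul, ZMod.natCast_self,
      mul_zero, zero_sub] at h3
    exact h3

/-- A row level set `{b ∈ ℤ/Lℤ : cos(2πb/L) = c}` has at most two elements. [folklore] -/
theorem card_filter_cos_eq_le_two (c : ℝ) :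
    (univ.filter fun b : ZMod L => Real.cos (2 * π * (b.val : ℝ) / L) = c).card ≤ 2 := by
  by_cases hne : (univ.filter fun b : ZMod L => Real.cos (2 * π * (b.val : ℝ) / L) = c).Nonempty
  · obtain ⟨a, ha⟩ := hne
    have hsub : (univ.filter fun b : ZMod L => Real.cos (2 * π * (b.val : ℝ) / L) = c) ⊆ {a, -a} := by
      intro b hb
      rw [mem_filter] at ha hb
      have h := zmod_eq_or_eq_neg_of_cos_eq (L := L) (ha.2.trans hb.2.symm)
      simp only [mem_insert, mem_singleton]
      exact h
    exact (card_le_card hsub).trans Finset.card_le_two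
  · rw [not_nonempty_iff_eq_empty.1 hne, card_empty]
    exact Nat.zero_le _

omit [NeZero L] in
/-- The band in coordinates: `ε_L(k) = -2(cos(2πk₀/L) + cos(2πk₁/L))`. [folklore] -/
theorem torusBand_two_eq (k : TorusSite 2 L) :
    torusBand L k = -2 * (Real.cos (2 * π * ((k 0).val : ℝ) / L) + Real.cos (2 * π * ((k 1).val : ℝ) / L)) := by
  simp only [torusBand, latticeMomentum, Fin.sum_univ_two]

/-- **Level sets of the square-lattice band are thin**: `#{k ∈ (ℤ/Lℤ)² : ε_L(k) = c} ≤ 2L` for every real `c`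
(at most two points per row). [folklore] -/
theorem card_levelSet_torusBand_le (c : ℝ) :
    (univ.filter fun k : TorusSite 2 L => torusBand L k = c).card ≤ 2 * L := by
  set S := univ.filter fun k : TorusSite 2 L => torusBand L k = c with hS
  have hfib : ∀ k₀ : ZMod L, (S.filter fun k => k 0 = k₀).card ≤ 2 := by
    intro k₀
    set c' : ℝ := -c / 2 - Real.cos (2 * π * (k₀.val : ℝ) / L) with hc'
    refine le_trans (Finset.card_le_card_of_injOn (fun k : TorusSite 2 L => k 1)
      (t := univ.filter fun b : ZMod L => Real.cos (2 * π * (b.val : ℝ) / L) = c') ?_ ?_)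
      (card_filter_cos_eq_le_two c')
    · intro k hk
      simp only [coe_filter, Set.mem_setOf_eq, mem_filter, mem_univ, true_and, hS] at hk ⊢
      obtain ⟨hband, hk0⟩ := hk
      have h := torusBand_two_eq k
      rw [hband, hk0] at h
      rw [hc']
      linarith
    · intro k hk k' hk' hkk'
      simp only [coe_filter, Set.mem_setOf_eq, mem_filter, hS] at hk hk'
      funext i
      fin_cases i
      · exact hk.2.trans hk'.2.symm
      · exact hkk'
  calc S.card = ∑ k₀ : ZMod L, (S.filter fun k => k 0 = k₀).card :=
        Finset.card_eq_sum_card_fiberwise (f := fun k : TorusSite 2 L => k 0) (fun _ _ => mem_univ _)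
    _ ≤ ∑ _k₀ : ZMod L, 2 := Finset.sum_le_sum fun k₀ _ => hfib k₀
    _ = 2 * L := by rw [sum_const, card_univ, ZMod.card, smul_eq_mul, mul_comm]


end LevelSet

/-! ## Part II. The pair intensity of a state with a sharp `↑` Fermi step -/

section PairBound

variable {L : ℕ} [NeZero L]

/-! ### Mode calculus on vectors -/

omit [NeZero L] in
/-- `⟨x, Aᴴ y⟩ = ⟨A x, y⟩`. [folklore] -/
theorem star_dotProduct_conjTranspose_mulVec' {n : Type*} [Fintype n] (A : Matrix n n ℂ) (x y : n → ℂ) :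
    star x ⬝ᵥ (Aᴴ *ᵥ y) = star (A *ᵥ x) ⬝ᵥ y := by
  rw [star_mulVec, dotProduct_mulVec]

omit [NeZero L] in
/-- `⟨x, A y⟩ = ⟨Aᴴ x, y⟩`. [folklore] -/
theorem star_dotProduct_mulVec_eq {n : Type*} [Fintype n] (A : Matrix n n ℂ) (x y : n → ℂ) :
    star x ⬝ᵥ (A *ᵥ y) = star (Aᴴ *ᵥ x) ⬝ᵥ y := by
  rw [← star_dotProduct_conjTranspose_mulVec', conjTranspose_conjTranspose]

/-- **The one-mode Pythagoras**: `‖c_{kσ} φ‖² + ‖c†_{kσ} φ‖² = ‖φ‖²` (the mixed CAR `c c† + c† c = 1`). [folklore] -/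
theorem eucNorm_sq_ann_add_eucNorm_sq_cre (k : TorusSite 2 L) (σ : Fin 2) (φ : Fock (Orb (FermionTorus 2 L))) :
    eucNorm (momentumAnnihilation k σ *ᵥ φ) ^ 2 + eucNorm (momentumCreation k σ *ᵥ φ) ^ 2 = eucNorm φ ^ 2 := by
  have h1 : star (momentumAnnihilation k σ *ᵥ φ) ⬝ᵥ (momentumAnnihilation k σ *ᵥ φ) =
      star φ ⬝ᵥ ((momentumCreation k σ * momentumAnnihilation k σ) *ᵥ φ) := by
    rw [← mulVec_mulVec, ← momentumAnnihilation_conjTranspose, star_dotProduct_conjTranspose_mulVec']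
  have h2 : star (momentumCreation k σ *ᵥ φ) ⬝ᵥ (momentumCreation k σ *ᵥ φ) =
      star φ ⬝ᵥ ((momentumAnnihilation k σ * momentumCreation k σ) *ᵥ φ) := by
    rw [← mulVec_mulVec, ← star_dotProduct_conjTranspose_mulVec', momentumCreation_conjTranspose]
  have hsum : star (momentumAnnihilation k σ *ᵥ φ) ⬝ᵥ (momentumAnnihilation k σ *ᵥ φ) +
      star (momentumCreation k σ *ᵥ φ) ⬝ᵥ (momentumCreation k σ *ᵥ φ) = star φ ⬝ᵥ φ := by
    rw [h1, h2, ← dotProduct_add, ← add_mulVec, add_comm, momentumAnnihilation_mul_momentumCreation_add,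
      if_pos ⟨rfl, rfl⟩, one_mulVec]
  have := congrArg Complex.re hsum
  rw [Complex.add_re, ← eucNorm_sq, ← eucNorm_sq, ← eucNorm_sq] at this
  exact this

/-- Annihilators are contractions: `‖c_{kσ} φ‖ ≤ ‖φ‖`. [folklore] -/
theorem eucNorm_momentumAnnihilation_mulVec_le (k : TorusSite 2 L) (σ : Fin 2)
    (φ : Fock (Orb (FermionTorus 2 L))) :
    eucNorm (momentumAnnihilation k σ *ᵥ φ) ≤ eucNorm φ := by
  have h := eucNorm_sq_ann_add_eucNorm_sq_cre k σ φ
  nlinarith [eucNorm_nonneg (momentumAnnihilation k σ *ᵥ φ), eucNorm_nonneg φ,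
    sq_nonneg (eucNorm (momentumCreation k σ *ᵥ φ))]

/-- Creators are contractions: `‖c†_{kσ} φ‖ ≤ ‖φ‖`. [folklore] -/
theorem eucNorm_momentumCreation_mulVec_le (k : TorusSite 2 L) (σ : Fin 2)
    (φ : Fock (Orb (FermionTorus 2 L))) :
    eucNorm (momentumCreation k σ *ᵥ φ) ≤ eucNorm φ := by
  have h := eucNorm_sq_ann_add_eucNorm_sq_cre k σ φ
  nlinarith [eucNorm_nonneg (momentumCreation k σ *ᵥ φ), eucNorm_nonneg φ,
    sq_nonneg (eucNorm (momentumAnnihilation k σ *ᵥ φ))]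

/-- The occupation expectation is the squared norm of the annihilated vector:
`re⟨φ, n_{kσ} φ⟩ = ‖c_{kσ} φ‖²`. [folklore] -/
theorem re_expect_momentumNumber (k : TorusSite 2 L) (σ : Fin 2) (φ : Fock (Orb (FermionTorus 2 L))) :
    (star φ ⬝ᵥ (momentumNumber k σ *ᵥ φ)).re = eucNorm (momentumAnnihilation k σ *ᵥ φ) ^ 2 := by
  rw [momentumNumber, ← mulVec_mulVec, ← momentumAnnihilation_conjTranspose,
    star_dotProduct_conjTranspose_mulVec', eucNorm_sq]

/-- The hole expectation is the squared norm of the created vector: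
`‖φ‖² - re⟨φ, n_{kσ} φ⟩ = ‖c†_{kσ} φ‖²`. [folklore] -/
theorem eucNorm_sq_sub_re_expect_momentumNumber (k : TorusSite 2 L) (σ : Fin 2)
    (φ : Fock (Orb (FermionTorus 2 L))) :
    eucNorm φ ^ 2 - (star φ ⬝ᵥ (momentumNumber k σ *ᵥ φ)).re = eucNorm (momentumCreation k σ *ᵥ φ) ^ 2 := by
  rw [re_expect_momentumNumber, ← eucNorm_sq_ann_add_eucNorm_sq_cre k σ φ]
  ring

/-! ### Pair modes against a sharp `↑` Fermi step -/

/-- `b_k ψ = 0` when `c_{k↑} ψ = 0`. [folklore] -/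
theorem pairMode_mulVec_eq_zero_of_up {k : TorusSite 2 L} {ψ : Fock (Orb (FermionTorus 2 L))}
    (h : momentumAnnihilation k 0 *ᵥ ψ = 0) : pairMode k *ᵥ ψ = 0 := by
  rw [pairMode, ← mulVec_mulVec, h, mulVec_zero]

/-- `‖b_k ψ‖ ≤ ‖ψ‖`. [folklore] -/
theorem eucNorm_pairMode_mulVec_le (k : TorusSite 2 L) (ψ : Fock (Orb (FermionTorus 2 L))) :
    eucNorm (pairMode k *ᵥ ψ) ≤ eucNorm ψ := by
  rw [pairMode, ← mulVec_mulVec]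
  exact (eucNorm_momentumAnnihilation_mulVec_le _ _ _).trans (eucNorm_momentumAnnihilation_mulVec_le _ _ _)

/-- Moving `c†_{k'↑}` through `b†_{k'} b_k` for `k ≠ k'`:
`c†_{k'↑} c†_{-k'↓} c_{-k↓} c_{k↑} = - c†_{-k'↓} c_{-k↓} c_{k↑} c†_{k'↑}` (three anticommutations, no
contractions). [folklore] -/
theorem creationUp_mul_through {k k' : TorusSite 2 L} (hkk' : k ≠ k') :
    momentumCreation k' 0 * (momentumCreation (-k') 1 * (momentumAnnihilation (-k) 1 * momentumAnnihilation k 0)) =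
      -(momentumCreation (-k') 1 * (momentumAnnihilation (-k) 1 * (momentumAnnihilation k 0 * momentumCreation k' 0))) := by
  have h1 : momentumCreation k' 0 * momentumCreation (-k') 1 = -(momentumCreation (-k') 1 * momentumCreation k' 0) :=
    momentumCreation_mul_eq_neg k' (-k') 0 1
  have h2 : momentumCreation k' 0 * momentumAnnihilation (-k) 1 = -(momentumAnnihilation (-k) 1 * momentumCreation k' 0) := by
    have h := momentumAnnihilation_mul_momentumCreation (-k) k' 1 0
    have hne : ¬ (-k = k' ∧ (1 : Fin 2) = 0) := fun h => absurd h.2 (by decide)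
    rw [if_neg hne, zero_sub] at h
    rw [h, neg_neg]
  have h3 : momentumCreation k' 0 * momentumAnnihilation k 0 = -(momentumAnnihilation k 0 * momentumCreation k' 0) := by
    have h := momentumAnnihilation_mul_momentumCreation k k' 0 0
    have hne : ¬ (k = k' ∧ (0 : Fin 2) = 0) := fun h => hkk' h.1
    rw [if_neg hne, zero_sub] at h
    rw [h, neg_neg]
  calc momentumCreation k' 0 * (momentumCreation (-k') 1 * (momentumAnnihilation (-k) 1 * momentumAnnihilation k 0))
      = (momentumCreation k' 0 * momentumCreation (-k') 1) * (momentumAnnihilation (-k) 1 * momentumAnnihilation k 0) :=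
        (Matrix.mul_assoc _ _ _).symm
    _ = -(momentumCreation (-k') 1 * (momentumCreation k' 0 * (momentumAnnihilation (-k) 1 * momentumAnnihilation k 0))) := by
        rw [h1, neg_mul, Matrix.mul_assoc]
    _ = -(momentumCreation (-k') 1 * ((momentumCreation k' 0 * momentumAnnihilation (-k) 1) * momentumAnnihilation k 0)) := by
        rw [← Matrix.mul_assoc (momentumCreation k' 0) (momentumAnnihilation (-k) 1) (momentumAnnihilation k 0)]
    _ = momentumCreation (-k') 1 * (momentumAnnihilation (-k) 1 * (momentumCreation k' 0 * momentumAnnihilation k 0)) := by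
        rw [h2, neg_mul, Matrix.mul_neg, neg_neg, Matrix.mul_assoc]
    _ = -(momentumCreation (-k') 1 * (momentumAnnihilation (-k) 1 * (momentumAnnihilation k 0 * momentumCreation k' 0))) := by
        rw [h3, Matrix.mul_neg, Matrix.mul_neg]

/-- **Orthogonality below the step**: if `c†_{k'↑} ψ = 0` and `k ≠ k'` then `b†_{k'} b_k ψ = 0`, hence
`⟨b_{k'} ψ, b_k ψ⟩ = 0`. [folklore] -/
theorem star_pairMode_mulVec_dotProduct_eq_zero {k k' : TorusSite 2 L} (hkk' : k ≠ k')
    {ψ : Fock (Orb (FermionTorus 2 L))} (h : momentumCreation k' 0 *ᵥ ψ = 0) :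
    star (pairMode k' *ᵥ ψ) ⬝ᵥ (pairMode k *ᵥ ψ) = 0 := by
  rw [← star_dotProduct_conjTranspose_mulVec', pairMode_conjTranspose, pairMode, mulVec_mulVec,
    Matrix.mul_assoc, creationUp_mul_through hkk', neg_mulVec, ← mulVec_mulVec, ← mulVec_mulVec,
    ← mulVec_mulVec, h, mulVec_zero, mulVec_zero, mulVec_zero, neg_zero, dotProduct_zero]

/-! ### Euclidean-norm bookkeeping for finite sums -/

omit [NeZero L] in
/-- `‖Σ_{i∈s} v_i‖ ≤ Σ_{i∈s} ‖v_i‖`. [folklore] -/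
theorem eucNorm_sum_le {n : Type*} [Fintype n] [DecidableEq n] {ι : Type*} (s : Finset ι) (v : ι → n → ℂ) :
    eucNorm (∑ i ∈ s, v i) ≤ ∑ i ∈ s, eucNorm (v i) := by
  classical
  induction s using Finset.induction_on with
  | empty => simp
  | insert a s ha ih =>
    rw [Finset.sum_insert ha, Finset.sum_insert ha]
    exact (eucNorm_add_le _ _).trans (by linarith)

omit [NeZero L] in
/-- Expansion of `⟨Σ a_i v_i, Σ a_j v_j⟩` with pairwise orthogonal `v`: only the diagonal survives. [folklore] -/
theorem star_sum_smul_dotProduct_sum_smul_of_orthogonal {n : Type*} [Fintype n] {ι : Type*} [DecidableEq ι]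
    (s : Finset ι) (a : ι → ℂ) (v : ι → n → ℂ)
    (horth : ∀ i ∈ s, ∀ j ∈ s, i ≠ j → star (v i) ⬝ᵥ v j = 0) :
    star (∑ i ∈ s, a i • v i) ⬝ᵥ (∑ j ∈ s, a j • v j) = ∑ i ∈ s, (star (a i) * a i) * (star (v i) ⬝ᵥ v i) := by
  rw [star_sum, sum_dotProduct]
  refine Finset.sum_congr rfl fun i hi => ?_
  rw [dotProduct_sum, Finset.sum_eq_single i]
  · rw [star_smul, smul_dotProduct, dotProduct_smul, smul_eq_mul, smul_eq_mul, mul_assoc]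
  · intro j hj hji
    rw [star_smul, smul_dotProduct, dotProduct_smul, horth i hi j hj (Ne.symm hji), smul_zero, smul_zero]
  · intro h; exact absurd hi h

/-! ### The pair bound -/

/-- **Pair intensity against a sharp `↑` Fermi step.** For a unit vector `ψ` with `c_{k↑} ψ = 0` above `μ` and
`c†_{k↑} ψ = 0` below `μ`:
`re⟨ψ, P†P ψ⟩ ≤ 8 (2·(4 L²) + 2·(2·#{k : ε_L(k) = μ})²)`, `P = pairField dWaveFormFactor L`. [folklore] -/
theorem re_expect_pairIntensity_le_of_fermiStep (μ : ℝ) {ψ : Fock (Orb (FermionTorus 2 L))}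
    (hψ1 : star ψ ⬝ᵥ ψ = 1)
    (hA : ∀ k : TorusSite 2 L, μ < torusBand L k → momentumAnnihilation k 0 *ᵥ ψ = 0)
    (hB : ∀ k : TorusSite 2 L, torusBand L k < μ → momentumCreation k 0 *ᵥ ψ = 0) :
    (expect ((pairField dWaveFormFactor L)ᴴ * pairField dWaveFormFactor L) ψ).re ≤
      8 * (2 * (4 * (L : ℝ) ^ 2) +
        2 * (2 * ((univ.filter fun k : TorusSite 2 L => torusBand L k = μ).card : ℝ)) ^ 2) := by
  classical
  -- the three momentum regions
  set Blo := univ.filter fun k : TorusSite 2 L => torusBand L k < μ with hBlo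
  set Lev := univ.filter fun k : TorusSite 2 L => torusBand L k = μ with hLev
  set v : TorusSite 2 L → Fock (Orb (FermionTorus 2 L)) := fun k => pairMode k *ᵥ ψ with hv
  set a : TorusSite 2 L → ℂ := fun k => ((dWaveGap k : ℝ) : ℂ) with ha
  -- `B ψ = Σ_k ĝ_k b_k ψ = Σ_Blo + Σ_Lev` (the region above `μ` contributes nothing)
  have hBψ : pairOperator dWaveGap univ *ᵥ ψ = ∑ k ∈ Blo, a k • v k + ∑ k ∈ Lev, a k • v k := by
    rw [pairOperator, sum_mulVec]
    simp only [smul_mulVec]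
    have hsplit : ∀ f : TorusSite 2 L → Fock (Orb (FermionTorus 2 L)),
        ∑ k, f k = ∑ k ∈ Blo, f k + (∑ k ∈ Lev, f k + ∑ k ∈ univ.filter (fun k => μ < torusBand L k), f k) := by
      intro f
      rw [← Finset.sum_filter_add_sum_filter_not univ (fun k => torusBand L k < μ) f]
      congr 1
      rw [← Finset.sum_filter_add_sum_filter_not (univ.filter fun k => ¬ torusBand L k < μ)
        (fun k => torusBand L k = μ) f, Finset.filter_filter, Finset.filter_filter]
      congr 1
      · refine Finset.sum_congr ?_ fun _ _ => rfl
        ext k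
        simp only [mem_filter, mem_univ, true_and, hLev]
        constructor
        · intro h; exact h.2
        · intro h; exact ⟨by rw [h]; exact lt_irrefl _, h⟩
      · refine Finset.sum_congr ?_ fun _ _ => rfl
        ext k
        simp only [mem_filter, mem_univ, true_and, not_lt]
        constructor
        · intro h; exact lt_of_le_of_ne h.1 (Ne.symm h.2)
        · intro h; exact ⟨h.le, ne_of_gt h⟩
    have hAbv : ∑ k ∈ univ.filter (fun k => μ < torusBand L k), a k • v k = 0 := by
      refine Finset.sum_eq_zero fun k hk => ?_
      rw [mem_filter] at hk
      rw [hv]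
      simp only
      rw [pairMode_mulVec_eq_zero_of_up (hA k hk.2), smul_zero]
    rw [hsplit, hAbv, add_zero]
  -- norms of the pieces
  have hv1 : ∀ k, eucNorm (v k) ≤ 1 := fun k => by
    rw [hv]
    exact (eucNorm_pairMode_mulVec_le k ψ).trans (eucNorm_eq_one hψ1).le
  have ha2 : ∀ k, ‖a k‖ ≤ 2 := fun k => by
    rw [ha]
    simp only [Complex.norm_real, Real.norm_eq_abs]
    exact abs_dWaveGap_le_two k
  -- below `μ`: orthogonality, `‖x‖² ≤ 4 |Blo| ≤ 4 L²`
  have horth : ∀ i ∈ Blo, ∀ j ∈ Blo, i ≠ j → star (v i) ⬝ᵥ v j = 0 := by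
    intro i hi j _ hij
    rw [hBlo, mem_filter] at hi
    exact star_pairMode_mulVec_dotProduct_eq_zero (Ne.symm hij) (hB i hi.2)
  have hx : eucNorm (∑ k ∈ Blo, a k • v k) ^ 2 ≤ 4 * (L : ℝ) ^ 2 := by
    rw [eucNorm_sq, star_sum_smul_dotProduct_sum_smul_of_orthogonal Blo a v horth, Complex.re_sum]
    have hterm : ∀ k ∈ Blo, ((star (a k) * a k) * (star (v k) ⬝ᵥ v k)).re ≤ 4 := by
      intro k _
      rw [star_dotProduct_self_eq_eucNorm_sq, Complex.star_def, Complex.conj_mul', ← Complex.ofReal_pow,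
        ← Complex.ofReal_mul, Complex.ofReal_re]
      have h1 : ‖a k‖ ^ 2 ≤ 4 := by nlinarith [ha2 k, norm_nonneg (a k)]
      have h2 : eucNorm (v k) ^ 2 ≤ 1 := by nlinarith [hv1 k, eucNorm_nonneg (v k)]
      nlinarith [sq_nonneg ‖a k‖, sq_nonneg (eucNorm (v k))]
    calc ∑ k ∈ Blo, ((star (a k) * a k) * (star (v k) ⬝ᵥ v k)).re ≤ ∑ _k ∈ Blo, (4:ℝ) :=
          Finset.sum_le_sum hterm
      _ = 4 * Blo.card := by rw [sum_const, nsmul_eq_mul, mul_comm]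
      _ ≤ 4 * (L : ℝ) ^ 2 := by
          have : Blo.card ≤ L ^ 2 := by
            calc Blo.card ≤ (univ : Finset (TorusSite 2 L)).card := card_le_card (filter_subset _ _)
              _ = L ^ 2 := by rw [card_univ, Fintype.card_pi, Fin.prod_const, ZMod.card]
          have : (Blo.card : ℝ) ≤ (L : ℝ) ^ 2 := by exact_mod_cast this
          linarith
  -- on the level set: triangle inequality, `‖y‖ ≤ 2 |Lev|`
  have hy : eucNorm (∑ k ∈ Lev, a k • v k) ≤ 2 * (Lev.card : ℝ) := by
    calc eucNorm (∑ k ∈ Lev, a k • v k) ≤ ∑ k ∈ Lev, eucNorm (a k • v k) := eucNorm_sum_le Lev _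
      _ ≤ ∑ _k ∈ Lev, (2:ℝ) := Finset.sum_le_sum fun k _ => by
          rw [eucNorm_smul]
          nlinarith [ha2 k, hv1 k, norm_nonneg (a k), eucNorm_nonneg (v k)]
      _ = 2 * Lev.card := by rw [sum_const, nsmul_eq_mul, mul_comm]
  -- assemble
  have hP : pairField dWaveFormFactor L *ᵥ ψ =
      -(((2 * Real.sqrt 2 : ℝ) : ℂ) • (pairOperator dWaveGap univ *ᵥ ψ)) := by
    rw [pairField_dWave_eq_smul_pairOperator, neg_mulVec, smul_mulVec]
  have hexp : (Literature.MathematicalPhysics.QuantumLattice.expect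
      ((pairField dWaveFormFactor L)ᴴ * pairField dWaveFormFactor L) ψ).re =
      8 * eucNorm (pairOperator dWaveGap univ *ᵥ ψ) ^ 2 := by
    rw [Literature.MathematicalPhysics.QuantumLattice.expect, ← mulVec_mulVec,
      star_dotProduct_conjTranspose_mulVec', ← eucNorm_sq, hP, eucNorm_neg, eucNorm_smul, mul_pow,
      Complex.norm_real, Real.norm_eq_abs, abs_of_pos (by positivity), mul_pow, Real.sq_sqrt (by norm_num)]
    norm_num
  rw [hexp, hBψ]
  have hsum := eucNorm_add_le (∑ k ∈ Blo, a k • v k) (∑ k ∈ Lev, a k • v k)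
  have h0x := eucNorm_nonneg (∑ k ∈ Blo, a k • v k)
  have h0y := eucNorm_nonneg (∑ k ∈ Lev, a k • v k)
  have h0s := eucNorm_nonneg (∑ k ∈ Blo, a k • v k + ∑ k ∈ Lev, a k • v k)
  have hy2 : eucNorm (∑ k ∈ Lev, a k • v k) ^ 2 ≤ (2 * (Lev.card : ℝ)) ^ 2 := by
    nlinarith [hy, h0y]
  nlinarith [hsum, h0x, h0y, h0s, hx, hy2, sq_nonneg (eucNorm (∑ k ∈ Blo, a k • v k) - eucNorm (∑ k ∈ Lev, a k • v k))]


end PairBound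

/-! ## Part III. The aufbau state and the Fermi step of every free sector ground state -/

section Aufbau

open Summit.HubbardSuperconductivity.TwTipContinuation.IsogapTransport

variable {L : ℕ} [NeZero L]

/-- The pair-filled aufbau vector `Φ_l = Π_{k ∈ l} b†_k |0⟩` (local notation for the literal term, exactly as in
`Literature/…/PairedProductStates.lean`, whose calculus — `star_pairedState_dotProduct_self`,
`momentumNumber_{up,down}_pairedState_of_{mem,not_mem}` — is used below). -/
local notation "Φ[" l "]" =>
  (List.prod (List.map (fun k => (pairMode k)ᴴ) l) *ᵥ (vacuum : Fock (Orb (FermionTorus 2 _))))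

/-- `Φ_l` lies in the sector `(N↑, N↓) = (|l|, |l|)`. [folklore] -/
theorem aufbau_isInSector (l : List (TorusSite 2 L)) : IsInSector l.length l.length (Φ[l]) := by
  induction l with
  | nil =>
    simpa only [List.map_nil, List.prod_nil, one_mulVec, List.length_nil] using
      (IsInSector.vacuum : IsInSector 0 0 (vacuum : Fock (Orb (FermionTorus 2 L))))
  | cons k l ih =>
    rw [List.map_cons, List.prod_cons, ← mulVec_mulVec, pairMode_conjTranspose, List.length_cons]
    exact isInSector_pairCreator_mulVec k (-k) ih

/-! ### A Fermi level for `n` levels per spin, and the aufbau set -/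

/-- **A Fermi level exists**: for `n ≤ L²` there is `μ` with `#{ε < μ} ≤ n ≤ #{ε ≤ μ}` (take `μ` the least
level whose closed lower set has at least `n` points). [folklore] -/
theorem exists_fermiLevel (ε : TorusSite 2 L → ℝ) {n : ℕ} (hn : n ≤ Fintype.card (TorusSite 2 L)) :
    ∃ μ : ℝ, (univ.filter fun k => ε k < μ).card ≤ n ∧ n ≤ (univ.filter fun k => ε k ≤ μ).card := by
  classical
  set A := univ.filter fun k : TorusSite 2 L => n ≤ (univ.filter fun j => ε j ≤ ε k).card with hA
  have hAne : A.Nonempty := by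
    obtain ⟨k₀, -, hk₀⟩ := Finset.exists_max_image univ ε univ_nonempty
    refine ⟨k₀, ?_⟩
    rw [hA, mem_filter]
    refine ⟨mem_univ _, ?_⟩
    have : (univ.filter fun j => ε j ≤ ε k₀) = univ := by
      ext j
      simp only [mem_filter, mem_univ, true_and, iff_true]
      exact hk₀ j (mem_univ j)
    rw [this, card_univ]
    exact hn
  obtain ⟨kstar, hkA, hmin⟩ := Finset.exists_min_image A ε hAne
  refine ⟨ε kstar, ?_, ?_⟩
  · by_contra hlt
    push Not at hlt
    have hne : (univ.filter fun k => ε k < ε kstar).Nonempty := by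
      rw [← Finset.card_pos]; omega
    obtain ⟨j₀, hj₀, hj₀max⟩ := Finset.exists_max_image _ ε hne
    rw [mem_filter] at hj₀
    have hsub : (univ.filter fun k => ε k < ε kstar) ⊆ (univ.filter fun j => ε j ≤ ε j₀) := by
      intro k hk
      rw [mem_filter] at hk ⊢
      exact ⟨mem_univ _, hj₀max k (by rw [mem_filter]; exact hk)⟩
    have hj₀A : j₀ ∈ A := by
      rw [hA, mem_filter]
      exact ⟨mem_univ _, le_trans hlt.le (card_le_card hsub)⟩
    have := hmin j₀ hj₀A
    linarith [hj₀.2]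
  · rw [hA, mem_filter] at hkA
    exact hkA.2

/-- **The aufbau set**: `n ≤ L²` levels can be chosen containing every level strictly below a Fermi level `μ`
and none strictly above it. [folklore] -/
theorem exists_aufbauSet (ε : TorusSite 2 L → ℝ) {n : ℕ} (hn : n ≤ Fintype.card (TorusSite 2 L)) :
    ∃ (μ : ℝ) (F : Finset (TorusSite 2 L)),
      (∀ k, ε k < μ → k ∈ F) ∧ (∀ k ∈ F, ε k ≤ μ) ∧ F.card = n := by
  classical
  obtain ⟨μ, h1, h2⟩ := exists_fermiLevel ε hn
  have hst : (univ.filter fun k => ε k < μ) ⊆ (univ.filter fun k => ε k ≤ μ) := fun k hk => by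
    rw [mem_filter] at hk ⊢
    exact ⟨hk.1, hk.2.le⟩
  obtain ⟨F, hBF, hFS, hcard⟩ := Finset.exists_subsuperset_card_eq hst h1 h2
  refine ⟨μ, F, fun k hk => hBF (by rw [mem_filter]; exact ⟨mem_univ _, hk⟩), fun k hk => ?_, hcard⟩
  have := hFS hk
  rw [mem_filter] at this
  exact this.2

/-! ### Every free sector ground state has a sharp `↑` Fermi step -/

omit [NeZero L] in
/-- `‖v‖ = 0 → v = 0` for the Euclidean norm. [folklore] -/
theorem eq_zero_of_eucNorm_sq_eq_zero {v : Fock (Orb (FermionTorus 2 L))} (h : eucNorm v ^ 2 = 0) : v = 0 := by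
  have h2 : star v ⬝ᵥ v = 0 := by
    rw [star_dotProduct_self_eq_eucNorm_sq, h, Complex.ofReal_zero]
  exact dotProduct_star_self_eq_zero.1 h2

/-- **The Fermi step of a free sector ground state** (aufbau by an operator inequality). For `L ≥ 3` and a
normalised ground state `ψ` of the free torus `H₀ = hubbardTorus 2 L 1 0 = Σ_{kσ} ε_L(k) n_{kσ}` in the sector
`(2n, S^z = 0)` there is a Fermi level `μ` such that `c_{k↑} ψ = 0` for `ε_L(k) > μ` and `c†_{k↑} ψ = 0` for
`ε_L(k) < μ`. Proof: the per-mode slacks `τ_{kσ}(φ) = (ε_k-μ) re⟨φ,n_{kσ}φ⟩ - min(ε_k-μ,0)‖φ‖²` are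
nonnegative (`n`, `1-n` are squares of contractions) and sum to `re⟨φ,H₀φ⟩ - μ re⟨φ,Nφ⟩ - E₀(μ)‖φ‖²`; they all
vanish on the aufbau vector `Φ` of the sector (levels `< μ` filled, a subset of the level set `= μ` filled to
reach `n`), so by minimality `E* ≤ re⟨Φ,H₀Φ⟩` they sum to `≤ 0` on `ψ`, hence vanish termwise. [folklore] -/
theorem fermiStep_of_isGroundStateInSector (hL : 3 ≤ L) {n : ℕ} {ψ : Fock (Orb (FermionTorus 2 L))}
    (hψ : IsGroundStateInSector (hubbardTorus 2 L 1 0) (2 * n) 0 ψ) (hψ1 : star ψ ⬝ᵥ ψ = 1) :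
    ∃ μ : ℝ, (∀ k, μ < torusBand L k → momentumAnnihilation k 0 *ᵥ ψ = 0) ∧
      (∀ k, torusBand L k < μ → momentumCreation k 0 *ᵥ ψ = 0) := by
  classical
  have hmem := hψ.1
  have hne0 := hψ.2.1
  have hHψ := hψ.2.2
  have hsec : IsInSector n n ψ := (mem_szSector_two_mul_zero_iff n ψ).1 hmem
  -- `n ≤ L²`: some configuration with `n` up-electrons carries `ψ`
  have hn : n ≤ Fintype.card (TorusSite 2 L) := by
    obtain ⟨s, hs⟩ : ∃ s, ψ s ≠ 0 := by
      by_contra h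
      push Not at h
      exact hne0 (funext h)
    have hcard : (upPart s).card = n := by
      by_contra hc
      exact hs (hsec s (fun h => hc h.1))
    calc n = (upPart s).card := hcard.symm
      _ ≤ Fintype.card (FermionTorus 2 L) := Finset.card_le_univ _
      _ = Fintype.card (TorusSite 2 L) := Fintype.card_congr FermionTorus.equivTorusSite
  obtain ⟨μ, F, hBF, hFS, hFcard⟩ := exists_aufbauSet (torusBand L) hn
  -- the aufbau vector on `F`
  set l := F.toList with hl
  have hlnd : l.Nodup := F.nodup_toList
  have hlmem : ∀ k, k ∈ l ↔ k ∈ F := fun k => Finset.mem_toList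
  have hllen : l.length = n := by rw [hl, Finset.length_toList, hFcard]
  have hΦ1 : star (Φ[l]) ⬝ᵥ Φ[l] = 1 := star_pairedState_dotProduct_self hlnd
  have hΦsec : IsInSector n n (Φ[l]) := by
    have := aufbau_isInSector l
    rwa [hllen] at this
  have hΦmem : Φ[l] ∈ szSector (2 * n) (0:ℝ) := (mem_szSector_two_mul_zero_iff n _).2 hΦsec
  -- the slack of a vector at a mode
  set τ : Fock (Orb (FermionTorus 2 L)) → TorusSite 2 L → Fin 2 → ℝ := fun φ k σ =>
    (torusBand L k - μ) * (star φ ⬝ᵥ (momentumNumber k σ *ᵥ φ)).re -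
      min (torusBand L k - μ) 0 * eucNorm φ ^ 2 with hτ
  have hτ_nonneg : ∀ φ k σ, 0 ≤ τ φ k σ := by
    intro φ k σ
    simp only [hτ]
    rcases le_or_gt 0 (torusBand L k - μ) with h | h
    · rw [min_eq_right h, zero_mul, sub_zero, re_expect_momentumNumber]
      exact mul_nonneg h (sq_nonneg _)
    · rw [min_eq_left h.le]
      have := eucNorm_sq_sub_re_expect_momentumNumber k σ φ
      nlinarith [sq_nonneg (eucNorm (momentumCreation k σ *ᵥ φ))]
  -- the sum of the slacks
  have hH : ∀ φ : Fock (Orb (FermionTorus 2 L)), (star φ ⬝ᵥ (hubbardTorus 2 L 1 0 *ᵥ φ)).re =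
      ∑ k : TorusSite 2 L, ∑ σ : Fin 2, torusBand L k * (star φ ⬝ᵥ (momentumNumber k σ *ᵥ φ)).re := by
    intro φ
    rw [hubbardTorus_zero_eq_sum_momentumNumber hL]
    simp only [sum_mulVec, smul_mulVec, dotProduct_sum, dotProduct_smul, Complex.re_sum, smul_eq_mul,
      Complex.re_ofReal_mul]
  have hN : ∀ φ : Fock (Orb (FermionTorus 2 L)), (star φ ⬝ᵥ (totalNumber *ᵥ φ)).re =
      ∑ k : TorusSite 2 L, ∑ σ : Fin 2, (star φ ⬝ᵥ (momentumNumber k σ *ᵥ φ)).re := by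
    intro φ
    rw [totalNumber_eq_sum_momentumNumber]
    simp only [sum_mulVec, dotProduct_sum, Complex.re_sum]
  have hsumτ : ∀ φ : Fock (Orb (FermionTorus 2 L)), ∑ k, ∑ σ, τ φ k σ =
      (star φ ⬝ᵥ (hubbardTorus 2 L 1 0 *ᵥ φ)).re - μ * (star φ ⬝ᵥ (totalNumber *ᵥ φ)).re -
        (∑ k : TorusSite 2 L, ∑ _σ : Fin 2, min (torusBand L k - μ) 0) * eucNorm φ ^ 2 := by
    intro φ
    rw [hH, hN, Finset.mul_sum, Finset.sum_mul, ← Finset.sum_sub_distrib, ← Finset.sum_sub_distrib]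
    refine Finset.sum_congr rfl fun k _ => ?_
    rw [Finset.mul_sum, Finset.sum_mul, ← Finset.sum_sub_distrib, ← Finset.sum_sub_distrib]
    refine Finset.sum_congr rfl fun σ _ => ?_
    simp only [hτ]
    ring
  -- particle number on the sector
  have hNsec : ∀ φ : Fock (Orb (FermionTorus 2 L)), IsInSector n n φ →
      (star φ ⬝ᵥ (totalNumber *ᵥ φ)).re = 2 * n * eucNorm φ ^ 2 := by
    intro φ hφ
    rw [totalNumber_mulVec_of_isNParticle hφ.isNParticle, dotProduct_smul, smul_eq_mul,
      star_dotProduct_self_eq_eucNorm_sq, ← Complex.ofReal_natCast, ← Complex.ofReal_mul, Complex.ofReal_re]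
    push_cast
    ring
  -- every slack vanishes on the aufbau vector
  have heΦ : eucNorm (Φ[l]) ^ 2 = 1 := by rw [eucNorm_sq, hΦ1, Complex.one_re]
  have hτΦ0 : ∀ k, τ (Φ[l]) k 0 = 0 := by
    intro k
    simp only [hτ, heΦ, mul_one]
    by_cases hk : k ∈ F
    · rw [momentumNumber_up_pairedState_of_mem ((hlmem k).2 hk), hΦ1, Complex.one_re, mul_one,
        min_eq_left (sub_nonpos.2 (hFS k hk)), sub_self]
    · have hge : μ ≤ torusBand L k := by
        by_contra h
        push Not at h
        exact hk (hBF k h)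
      rw [momentumNumber_up_pairedState_of_not_mem ((hlmem k).not.2 hk), dotProduct_zero, Complex.zero_re,
        mul_zero, min_eq_right (sub_nonneg.2 hge), sub_self]
  have hτΦ1 : ∀ k, τ (Φ[l]) k 1 = 0 := by
    intro k
    simp only [hτ, heΦ, mul_one]
    by_cases hk : -k ∈ F
    · have hle : torusBand L k ≤ μ := by
        have := hFS (-k) hk
        rwa [torusBand_neg] at this
      have hnk := momentumNumber_down_pairedState_of_mem ((hlmem (-k)).2 hk)
      rw [neg_neg] at hnk
      rw [hnk, hΦ1, Complex.one_re, mul_one,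
        min_eq_left (sub_nonpos.2 hle), sub_self]
    · have hge : μ ≤ torusBand L k := by
        by_contra h
        push Not at h
        exact hk (hBF (-k) (by rw [torusBand_neg]; exact h))
      have hnk := momentumNumber_down_pairedState_of_not_mem ((hlmem (-k)).not.2 hk)
      rw [neg_neg] at hnk
      rw [hnk, dotProduct_zero, Complex.zero_re,
        mul_zero, min_eq_right (sub_nonneg.2 hge), sub_self]
  have hτΦ : ∀ k σ, τ (Φ[l]) k σ = 0 := by
    intro k σ
    fin_cases σ
    · exact hτΦ0 k
    · exact hτΦ1 k
  -- hence `re⟨Φ, H₀ Φ⟩ = 2nμ + E₀(μ)`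
  have hEΦ : (star (Φ[l]) ⬝ᵥ (hubbardTorus 2 L 1 0 *ᵥ Φ[l])).re =
      μ * (2 * n) + ∑ k : TorusSite 2 L, ∑ _σ : Fin 2, min (torusBand L k - μ) 0 := by
    have h := hsumτ (Φ[l])
    rw [Finset.sum_eq_zero (fun k _ => Finset.sum_eq_zero fun σ _ => hτΦ k σ), hNsec _ hΦsec, heΦ] at h
    linarith
  -- minimality of the ground-state energy
  have hHerm : (hubbardTorus 2 L 1 0).IsHermitian :=
    (hamiltonian_isHermitian_and_commute_holds (fermionTorusGraph 2 L) 1 0).1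
  have hmin : (hubbardTorus 2 L 1 0).minEnergyOn (szSector (2 * n) 0) ≤
      (star (Φ[l]) ⬝ᵥ (hubbardTorus 2 L 1 0 *ᵥ Φ[l])).re :=
    minEnergyOn_le_rayleigh_of_mem hHerm _ hΦmem hΦ1
  have hEψ : (star ψ ⬝ᵥ (hubbardTorus 2 L 1 0 *ᵥ ψ)).re =
      (hubbardTorus 2 L 1 0).minEnergyOn (szSector (2 * n) 0) := by
    rw [hHψ, dotProduct_smul, hψ1, smul_eq_mul, mul_one, Complex.ofReal_re]
  have heψ : eucNorm ψ ^ 2 = 1 := by rw [eucNorm_sq, hψ1, Complex.one_re]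
  -- the slacks of `ψ` sum to `≤ 0`, hence vanish termwise
  have hsumψ : ∑ k, ∑ σ, τ ψ k σ ≤ 0 := by
    rw [hsumτ ψ, hNsec ψ hsec, heψ, hEψ]
    nlinarith [hmin, hEΦ]
  have hτψ0 : ∀ k σ, τ ψ k σ = 0 := by
    have hinner : ∀ k, 0 ≤ ∑ σ, τ ψ k σ := fun k => Finset.sum_nonneg fun σ _ => hτ_nonneg ψ k σ
    have htot : ∑ k, ∑ σ, τ ψ k σ = 0 :=
      le_antisymm hsumψ (Finset.sum_nonneg fun k _ => hinner k)
    intro k σ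
    have hk := (Finset.sum_eq_zero_iff_of_nonneg (fun k _ => hinner k)).1 htot k (mem_univ k)
    exact (Finset.sum_eq_zero_iff_of_nonneg (fun σ _ => hτ_nonneg ψ k σ)).1 hk σ (mem_univ σ)
  refine ⟨μ, fun k hk => ?_, fun k hk => ?_⟩
  · -- above `μ`: `(ε-μ)‖c_{k↑}ψ‖² = 0`
    have h0 := hτψ0 k 0
    simp only [hτ, min_eq_right (sub_nonneg.2 hk.le), zero_mul, sub_zero, re_expect_momentumNumber] at h0
    rcases mul_eq_zero.1 h0 with h | h
    · linarith
    · exact eq_zero_of_eucNorm_sq_eq_zero h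
  · -- below `μ`: `(μ-ε)‖c†_{k↑}ψ‖² = 0`
    have h0 := hτψ0 k 0
    have hid := eucNorm_sq_sub_re_expect_momentumNumber k 0 ψ
    simp only [hτ, min_eq_left (sub_neg.2 hk).le, heψ, mul_one] at h0
    have hprod : (torusBand L k - μ) * eucNorm (momentumCreation k 0 *ᵥ ψ) ^ 2 = 0 := by
      rw [← hid, heψ]
      linarith
    rcases mul_eq_zero.1 hprod with h | h
    · linarith
    · exact eq_zero_of_eucNorm_sq_eq_zero h

end Aufbau

/-! ## Part IV. The free endpoint -/

section Endpoint

variable {L : ℕ} [NeZero L]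

/-- **The free torus has no `d`-wave pair order in ANY sector ground state.** For `L ≥ 3` and every
normalised ground state `ψ` of `hubbardTorus 2 L 1 0` in a sector `(2n, S^z = 0)`:
`re⟨ψ, P†P ψ⟩ ≤ 320 L²`, `P = pairField dWaveFormFactor L` (`= √2 Δ_d`). Since pair-field LRO asks for
`re⟨ψ, P†P ψ⟩ ≥ a L⁴`, no admissible sequence of the summit matrix at `U = 0` has it. [folklore] -/
theorem free_pairIntensity_le (hL : 3 ≤ L) (n : ℕ) (ψ : Fock (Orb (FermionTorus 2 L)))
    (hψ : IsGroundStateInSector (hubbardTorus 2 L 1 0) (2 * n) 0 ψ) (hψ1 : star ψ ⬝ᵥ ψ = 1) :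
    (Literature.MathematicalPhysics.QuantumLattice.expect
      ((pairField dWaveFormFactor L)ᴴ * pairField dWaveFormFactor L) ψ).re ≤ 320 * (L : ℝ) ^ 2 := by
  obtain ⟨μ, hA, hB⟩ := fermiStep_of_isGroundStateInSector hL hψ hψ1
  have h := re_expect_pairIntensity_le_of_fermiStep μ hψ1 hA hB
  have hlev : ((univ.filter fun k : TorusSite 2 L => torusBand L k = μ).card : ℝ) ≤ 2 * L := by
    exact_mod_cast card_levelSet_torusBand_le (L := L) μ
  have hc0 : (0:ℝ) ≤ ((univ.filter fun k : TorusSite 2 L => torusBand L k = μ).card : ℝ) := Nat.cast_nonneg _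
  have hc2 : ((univ.filter fun k : TorusSite 2 L => torusBand L k = μ).card : ℝ) ^ 2 ≤ (2 * (L:ℝ)) ^ 2 :=
    pow_le_pow_left₀ hc0 hlev 2
  calc _ ≤ 8 * (2 * (4 * (L : ℝ) ^ 2) +
        2 * (2 * ((univ.filter fun k : TorusSite 2 L => torusBand L k = μ).card : ℝ)) ^ 2) := h
    _ ≤ 320 * (L : ℝ) ^ 2 := by nlinarith [hc2]

end Endpoint

end Summit.HubbardSuperconductivity.HubbardSuperconductivity.Cruxes.CwThesis.Disproof.FreeEndpoint

/-! ## Appendix B (placed first for scoping): no floor survives `U → 0` at a fixed side — to land verbatim as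
`Theorems/CwThesis/Negative/UniformFloor.lean` -/

namespace Summit.HubbardSuperconductivity.HubbardSuperconductivity.Cruxes.CwThesis.Disproof.UniformFloor

open Matrix Finset Literature.MathematicalPhysics.QuantumLattice Literature.Barriers.HubbardSuperconductivity
open Literature.Probability.LatticeModels
open Filter Set
open scoped ComplexOrder Topology
open Summit.HubbardSuperconductivity.WcbcsSsbToTorusLRO.Negative

variable {L : ℕ}

/-- The coupling enters linearly: `H(U) = H(0) + U · Σ_x n_{x↑} n_{x↓}`. [folklore] -/
theorem hubbardTorus_eq_add_smul (L : ℕ) (U : ℝ) :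
    hubbardTorus 2 L 1 U = hubbardTorus 2 L 1 0 +
      (U : ℂ) • ∑ x : FermionTorus 2 L, numberOp x 0 * numberOp x 1 := by
  simp only [hubbardTorus, hamiltonian, Complex.ofReal_zero, zero_smul, add_zero]

/-- The unit sphere `{φ : star φ ⬝ᵥ φ = 1}` of the Fock space is compact. [folklore] -/
theorem isCompact_unitSphere_fock (L : ℕ) :
    IsCompact {φ : Fock (Orb (FermionTorus 2 L)) | star φ ⬝ᵥ φ = 1} := by
  have hclosed : IsClosed {φ : Fock (Orb (FermionTorus 2 L)) | star φ ⬝ᵥ φ = 1} :=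
    isClosed_eq (continuous_id.star.dotProduct continuous_id) continuous_const
  refine Metric.isCompact_of_isClosed_isBounded hclosed ?_
  refine (Metric.isBounded_closedBall (x := (0 : Fock (Orb (FermionTorus 2 L)))) (r := 1)).subset ?_
  intro φ hφ
  rw [Set.mem_setOf_eq] at hφ
  rw [Metric.mem_closedBall, dist_zero_right, pi_norm_le_iff_of_nonneg zero_le_one]
  intro s
  have hsum : (star φ ⬝ᵥ φ).re = ∑ t, ‖φ t‖ ^ 2 := by
    simp only [dotProduct, Pi.star_apply, Complex.re_sum, Complex.star_def, Complex.conj_mul',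
      ← Complex.ofReal_pow, Complex.ofReal_re]
  have hle : ‖φ s‖ ^ 2 ≤ 1 := by
    calc ‖φ s‖ ^ 2 ≤ ∑ t, ‖φ t‖ ^ 2 :=
          Finset.single_le_sum (f := fun t => ‖φ t‖ ^ 2) (fun t _ => sq_nonneg _) (Finset.mem_univ s)
      _ = 1 := by rw [← hsum, hφ, Complex.one_re]
  nlinarith [norm_nonneg (φ s)]

/-- **No floor survives `U → 0` at a fixed side and sector** (modulo a free bound). If every normalised ground
state of the free torus `hubbardTorus 2 L 1 0` in the sector `(2n, 0)` has pair intensity `≤ C`, and `C < a`,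
then along no sequence `U_j → 0` can ALL normalised ground states of `hubbardTorus 2 L 1 U_j` in that sector have
pair intensity `≥ a`. [folklore] -/
theorem no_floor_along_vanishing_couplings [NeZero L] {n : ℕ} (hn : n ≤ L ^ 2) {C a : ℝ} (hCa : C < a)
    (hfree : ∀ ψ : Fock (Orb (FermionTorus 2 L)),
      IsGroundStateInSector (hubbardTorus 2 L 1 0) (2 * n) 0 ψ → star ψ ⬝ᵥ ψ = 1 →
        (expect ((pairField dWaveFormFactor L)ᴴ * pairField dWaveFormFactor L) ψ).re ≤ C)
    (U : ℕ → ℝ) (hU0 : Tendsto U atTop (𝓝 0))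
    (hfloor : ∀ (j : ℕ) (ψ : Fock (Orb (FermionTorus 2 L))),
      IsGroundStateInSector (hubbardTorus 2 L 1 (U j)) (2 * n) 0 ψ → star ψ ⬝ᵥ ψ = 1 →
        a ≤ (expect ((pairField dWaveFormFactor L)ᴴ * pairField dWaveFormFactor L) ψ).re) :
    False := by
  classical
  -- notation
  set H : ℝ → Matrix (Finset (Orb (FermionTorus 2 L))) (Finset (Orb (FermionTorus 2 L))) ℂ :=
    fun V => hubbardTorus 2 L 1 V with hH
  set D : Matrix (Finset (Orb (FermionTorus 2 L))) (Finset (Orb (FermionTorus 2 L))) ℂ :=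
    ∑ x : FermionTorus 2 L, numberOp x 0 * numberOp x 1 with hD
  set Q : Matrix (Finset (Orb (FermionTorus 2 L))) (Finset (Orb (FermionTorus 2 L))) ℂ :=
    (pairField dWaveFormFactor L)ᴴ * pairField dWaveFormFactor L with hQ
  set K : Submodule ℂ (Fock (Orb (FermionTorus 2 L))) := szSector (2 * n) 0 with hK
  have hHU : ∀ V : ℝ, H V = H 0 + (V : ℂ) • D := fun V => hubbardTorus_eq_add_smul L V
  have hHerm : ∀ V : ℝ, (H V).IsHermitian := fun V =>
    (hamiltonian_isHermitian_and_commute_holds (fermionTorusGraph 2 L) 1 V).1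
  -- a normalised ground state at each coupling
  have hex : ∀ j : ℕ, ∃ ψ : Fock (Orb (FermionTorus 2 L)), star ψ ⬝ᵥ ψ = 1 ∧
      IsGroundStateInSector (H (U j)) (2 * n) 0 ψ := fun j => exists_unit_groundStateInSector L (U j) hn
  choose ψ hψ1 hψGS using hex
  -- compactness: a convergent subsequence
  obtain ⟨ψinf, hψinf1, g, hg, hlim⟩ :=
    (isCompact_unitSphere_fock L).tendsto_subseq (x := ψ) (fun j => hψ1 j)
  rw [Set.mem_setOf_eq] at hψinf1
  -- continuity tools
  have hcmul : ∀ A : Matrix (Finset (Orb (FermionTorus 2 L))) (Finset (Orb (FermionTorus 2 L))) ℂ,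
      Continuous fun v : Fock (Orb (FermionTorus 2 L)) => A *ᵥ v :=
    fun A => continuous_const.matrix_mulVec continuous_id
  have hcdot : Continuous fun p : Fock (Orb (FermionTorus 2 L)) × Fock (Orb (FermionTorus 2 L)) =>
      star p.1 ⬝ᵥ p.2 := (continuous_fst.star).dotProduct continuous_snd
  have hUg : Tendsto (fun i => ((U (g i) : ℝ) : ℂ)) atTop (𝓝 0) := by
    have h := (Complex.continuous_ofReal.tendsto 0).comp (hU0.comp hg.tendsto_atTop)
    rwa [Complex.ofReal_zero] at h
  -- `H(U_{g i}) ψ_{g i} → H(0) ψ∞`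
  have hHlim : Tendsto (fun i => H (U (g i)) *ᵥ ψ (g i)) atTop (𝓝 (H 0 *ᵥ ψinf)) := by
    have h1 : Tendsto (fun i => H 0 *ᵥ ψ (g i)) atTop (𝓝 (H 0 *ᵥ ψinf)) := ((hcmul (H 0)).tendsto _).comp hlim
    have h2 : Tendsto (fun i => D *ᵥ ψ (g i)) atTop (𝓝 (D *ᵥ ψinf)) := ((hcmul D).tendsto _).comp hlim
    have h3 := h1.add (hUg.smul h2)
    rw [zero_smul, add_zero] at h3
    refine h3.congr' (Eventually.of_forall fun i => ?_)
    show _ = H (U (g i)) *ᵥ ψ (g i)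
    rw [hHU (U (g i)), add_mulVec, smul_mulVec]
  -- the sector energies along the subsequence converge to `re⟨ψ∞, H(0) ψ∞⟩`
  set r : ℕ → ℝ := fun j => (H (U j)).minEnergyOn K with hr
  have hreig : ∀ j, star (ψ j) ⬝ᵥ (H (U j) *ᵥ ψ j) = ((r j : ℝ) : ℂ) := fun j => by
    rw [(hψGS j).2.2, dotProduct_smul, hψ1 j, smul_eq_mul, mul_one]
  set cinf : ℂ := star ψinf ⬝ᵥ (H 0 *ᵥ ψinf) with hcinf
  have hclim : Tendsto (fun i => ((r (g i) : ℝ) : ℂ)) atTop (𝓝 cinf) := by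
    have h := (hcdot.tendsto (ψinf, H 0 *ᵥ ψinf)).comp (hlim.prodMk_nhds hHlim)
    refine h.congr' (Eventually.of_forall fun i => ?_)
    simp only [Function.comp_apply]
    exact hreig (g i)
  have hrlim : Tendsto (fun i => r (g i)) atTop (𝓝 cinf.re) := by
    have h := (Complex.continuous_re.tendsto cinf).comp hclim
    refine h.congr' (Eventually.of_forall fun i => ?_)
    simp only [Function.comp_apply, Complex.ofReal_re]
  have hcim : cinf.im = 0 := by
    have h := (Complex.continuous_im.tendsto cinf).comp hclim
    have h0 : Tendsto (fun i : ℕ => ((r (g i) : ℝ) : ℂ).im) atTop (𝓝 0) := by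
      simp only [Complex.ofReal_im]; exact tendsto_const_nhds
    exact tendsto_nhds_unique h h0
  have hcre : cinf = ((cinf.re : ℝ) : ℂ) := Complex.ext (by simp) (by simp [hcim])
  -- the eigen-equation passes to the limit
  have heig : H 0 *ᵥ ψinf = cinf • ψinf := by
    have h1 : Tendsto (fun i => H (U (g i)) *ᵥ ψ (g i)) atTop (𝓝 (cinf • ψinf)) := by
      have h := hclim.smul hlim
      refine h.congr' (Eventually.of_forall fun i => ?_)
      simp only [Function.comp_apply]
      rw [(hψGS (g i)).2.2]
    exact tendsto_nhds_unique hHlim h1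
  -- `ψ∞` lies in the sector and is normalised
  have hKclosed : IsClosed (K : Set (Fock (Orb (FermionTorus 2 L)))) := K.closed_of_finiteDimensional
  have hψinfK : ψinf ∈ K :=
    hKclosed.mem_of_tendsto hlim (Eventually.of_forall fun i => (hψGS (g i)).1)
  have hψinf0 : ψinf ≠ 0 := by
    intro h
    rw [h, star_zero, zero_dotProduct] at hψinf1
    exact zero_ne_one hψinf1
  -- `re cinf` is the free sector energy
  have hge : (H 0).minEnergyOn K ≤ cinf.re := minEnergyOn_le_rayleigh_of_mem (hHerm 0) K hψinfK hψinf1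
  have hle : cinf.re ≤ (H 0).minEnergyOn K := by
    refine le_csInf ⟨_, ψinf, hψinfK, hψinf1, rfl⟩ ?_
    rintro E ⟨φ, hφK, hφ1, rfl⟩
    -- `r_{g i} ≤ re⟨φ, H(U_{g i}) φ⟩ → re⟨φ, H(0) φ⟩`
    have hφlim : Tendsto (fun i => (star φ ⬝ᵥ (H (U (g i)) *ᵥ φ)).re) atTop
        (𝓝 ((star φ ⬝ᵥ (H 0 *ᵥ φ)).re)) := by
      have h1 : Tendsto (fun i => (star φ ⬝ᵥ (H 0 *ᵥ φ)).re + U (g i) * (star φ ⬝ᵥ (D *ᵥ φ)).re) atTop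
          (𝓝 ((star φ ⬝ᵥ (H 0 *ᵥ φ)).re + 0 * (star φ ⬝ᵥ (D *ᵥ φ)).re)) :=
        tendsto_const_nhds.add ((hU0.comp hg.tendsto_atTop).mul tendsto_const_nhds)
      rw [zero_mul, add_zero] at h1
      refine h1.congr' (Eventually.of_forall fun i => ?_)
      show _ = (star φ ⬝ᵥ (H (U (g i)) *ᵥ φ)).re
      rw [hHU (U (g i)), add_mulVec, smul_mulVec, dotProduct_add, dotProduct_smul, Complex.add_re,
        smul_eq_mul, Complex.re_ofReal_mul]
    exact le_of_tendsto_of_tendsto' hrlim hφlim fun i =>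
      minEnergyOn_le_rayleigh_of_mem (hHerm (U (g i))) K hφK hφ1
  have hc_eq : cinf.re = (H 0).minEnergyOn K := le_antisymm hle hge
  -- so `ψ∞` is a free ground state in the sector
  have hGSinf : IsGroundStateInSector (H 0) (2 * n) 0 ψinf := by
    refine ⟨hψinfK, hψinf0, ?_⟩
    rw [heig, hcre, hc_eq]
  -- the floor passes to the limit and contradicts the free bound
  have hIcont : Continuous fun v : Fock (Orb (FermionTorus 2 L)) => (star v ⬝ᵥ (Q *ᵥ v)).re :=
    Complex.continuous_re.comp ((continuous_id.star).dotProduct (hcmul Q))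
  have hIlim : Tendsto (fun i => (star (ψ (g i)) ⬝ᵥ (Q *ᵥ ψ (g i))).re) atTop
      (𝓝 ((star ψinf ⬝ᵥ (Q *ᵥ ψinf)).re)) := (hIcont.tendsto ψinf).comp hlim
  have hfloor_inf : a ≤ (star ψinf ⬝ᵥ (Q *ᵥ ψinf)).re :=
    ge_of_tendsto hIlim (Eventually.of_forall fun i => hfloor (g i) (ψ (g i)) (hψGS (g i)) (hψ1 (g i)))
  have hfree_inf := hfree ψinf hGSinf hψinf1
  change (star ψinf ⬝ᵥ (Q *ᵥ ψinf)).re ≤ C at hfree_inf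
  linarith

/-- **The doubly-uniform strengthening of `CwThesis` is false, modulo the free bound.** If every normalised
sector ground state of the free torus (`L ≥ 3`) has pair intensity `≤ C L²`, then there are NO `U₀, a, k₀` such
that for every `U ∈ (0, U₀)` some doping `δ_U` of the window carries the floor `a L⁴` for ALL ground states at ALL
even sides `L = 2k+2 ≥ 2k₀+2`: along `U_j = U₀/(j+2) → 0` the prescribed particle numbers at a fixed large side
repeat infinitely often (pigeonhole), and `no_floor_along_vanishing_couplings` applies in that sector. (Compare
`cwThesis_iff_floor`: `X` itself lets both `a` and the threshold depend on `U`.) [folklore] -/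
theorem cwThesis_false_uniformFloor_of_freeBound {C : ℝ}
    (hfree : ∀ (L : ℕ) [NeZero L], 3 ≤ L → ∀ (n : ℕ) (ψ : Fock (Orb (FermionTorus 2 L))),
      IsGroundStateInSector (hubbardTorus 2 L 1 0) (2 * n) 0 ψ → star ψ ⬝ᵥ ψ = 1 →
        (expect ((pairField dWaveFormFactor L)ᴴ * pairField dWaveFormFactor L) ψ).re ≤ C * (L : ℝ) ^ 2) :
    ¬ ∃ U₀ a : ℝ, ∃ k₀ : ℕ, 0 < U₀ ∧ 0 < a ∧ ∀ U ∈ Ioo (0:ℝ) U₀, ∃ δ ∈ Icc (3/10 : ℝ) (12/25),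
        ∀ k : ℕ, k₀ ≤ k → ∀ ψ : Fock (Orb (FermionTorus 2 (2 * k + 1 + 1))),
          IsGroundStateInSector (hubbardTorus 2 (2 * k + 1 + 1) 1 U)
              (2 * ⌊(1 - δ) * (((2 * k + 1 + 1 : ℕ) : ℝ)) ^ 2 / 2⌋₊) 0 ψ →
            star ψ ⬝ᵥ ψ = 1 →
              a * ((2 * k + 1 + 1 : ℕ) : ℝ) ^ 4 ≤
                (expect ((pairField dWaveFormFactor (2 * k + 1 + 1))ᴴ *
                  pairField dWaveFormFactor (2 * k + 1 + 1)) ψ).re := by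
  classical
  rintro ⟨U₀, a, k₀, hU₀, ha, h⟩
  -- a large even side `2k+2`, `k ≥ k₀`, with `C (2k+2)² < a (2k+2)⁴`
  obtain ⟨m, hm⟩ := exists_nat_gt (C / a)
  obtain ⟨k, hk₀, hkm⟩ : ∃ k : ℕ, k₀ ≤ k ∧ m + 1 ≤ k := ⟨max k₀ (m + 1), le_max_left _ _, le_max_right _ _⟩
  haveI : NeZero (2 * k + 1 + 1) := ⟨by omega⟩
  have hL3 : 3 ≤ 2 * k + 1 + 1 := by omega
  have hLm : (m : ℝ) + 1 ≤ ((2 * k + 1 + 1 : ℕ) : ℝ) := by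
    have : m + 1 ≤ 2 * k + 1 + 1 := by omega
    exact_mod_cast this
  have hLpos : (0 : ℝ) < ((2 * k + 1 + 1 : ℕ) : ℝ) ^ 2 := by positivity
  have hCa : C * ((2 * k + 1 + 1 : ℕ) : ℝ) ^ 2 < a * ((2 * k + 1 + 1 : ℕ) : ℝ) ^ 4 := by
    have h1 : C < a * ((2 * k + 1 + 1 : ℕ) : ℝ) ^ 2 := by
      have hCa' : C / a < ((2 * k + 1 + 1 : ℕ) : ℝ) ^ 2 := by
        calc C / a < m := hm
          _ ≤ (m : ℝ) + 1 := by linarith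
          _ ≤ ((2 * k + 1 + 1 : ℕ) : ℝ) := hLm
          _ ≤ ((2 * k + 1 + 1 : ℕ) : ℝ) ^ 2 := by
              have h1 : (1:ℝ) ≤ ((2 * k + 1 + 1 : ℕ) : ℝ) := by
                have : 1 ≤ 2 * k + 1 + 1 := by omega
                exact_mod_cast this
              nlinarith
      rw [div_lt_iff₀ ha] at hCa'
      linarith [mul_comm a (((2 * k + 1 + 1 : ℕ) : ℝ) ^ 2)]
    have h4 : ((2 * k + 1 + 1 : ℕ) : ℝ) ^ 4 = ((2 * k + 1 + 1 : ℕ) : ℝ) ^ 2 * ((2 * k + 1 + 1 : ℕ) : ℝ) ^ 2 := by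
      ring
    rw [h4, ← mul_assoc]
    exact mul_lt_mul_of_pos_right h1 hLpos
  -- couplings `V_j = U₀/(j+2) → 0` inside `(0, U₀)`
  obtain ⟨V, hV⟩ : ∃ V : ℕ → ℝ, ∀ j, V j = U₀ / ((j : ℝ) + 2) := ⟨_, fun j => rfl⟩
  have hVmem : ∀ j, V j ∈ Ioo (0:ℝ) U₀ := fun j => by
    rw [hV]
    refine ⟨div_pos hU₀ (by positivity), ?_⟩
    rw [div_lt_iff₀ (by positivity)]
    nlinarith
  have hV0 : Tendsto V atTop (𝓝 0) := by
    have h1 : Tendsto (fun j : ℕ => (j : ℝ) + 2) atTop atTop :=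
      tendsto_natCast_atTop_atTop.atTop_add tendsto_const_nhds
    have h3 := h1.inv_tendsto_atTop.const_mul U₀
    rw [mul_zero] at h3
    refine h3.congr' (Eventually.of_forall fun j => ?_)
    rw [hV j, div_eq_mul_inv]
    rfl
  -- dopings and particle numbers at the chosen side
  choose δ hδ hfl using fun j => h (V j) (hVmem j)
  obtain ⟨nL, hnL⟩ : ∃ nL : ℕ → ℕ, ∀ j, nL j = ⌊(1 - δ j) * (((2 * k + 1 + 1 : ℕ) : ℝ)) ^ 2 / 2⌋₊ :=
    ⟨_, fun j => rfl⟩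
  have hnL_le : ∀ j, nL j ≤ (2 * k + 1 + 1) ^ 2 := fun j => by
    rw [hnL]
    exact halfFilling_floor_le_sq (2 * k + 1 + 1) (by linarith [(hδ j).1])
  -- pigeonhole: some particle number repeats infinitely often
  obtain ⟨y, hy⟩ := Finite.exists_infinite_fiber
    (fun j : ℕ => (⟨nL j, Nat.lt_succ_of_le (hnL_le j)⟩ : Fin ((2 * k + 1 + 1) ^ 2 + 1)))
  have hfreq : ∃ᶠ j in atTop, nL j = y.val := by
    rw [Nat.frequently_atTop_iff_infinite]
    have hinf := Set.infinite_coe_iff.1 hy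
    refine hinf.mono fun j hj => ?_
    simp only [Set.mem_preimage, Set.mem_singleton_iff] at hj
    simp only [Set.mem_setOf_eq, ← hj]
  obtain ⟨φ, hφ, hφP⟩ := Filter.extraction_of_frequently_atTop hfreq
  -- apply the fixed-sector lemma along `V ∘ φ` in the sector `(2 y, 0)`
  have hy_le : y.val ≤ (2 * k + 1 + 1) ^ 2 := Nat.le_of_lt_succ y.isLt
  refine no_floor_along_vanishing_couplings (L := 2 * k + 1 + 1) hy_le hCa
    (fun ψ hψ hψ1 => hfree (2 * k + 1 + 1) hL3 y.val ψ hψ hψ1) (V ∘ φ) (hV0.comp hφ.tendsto_atTop)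
    fun i ψ hψ hψ1 => ?_
  have hfl' := hfl (φ i) k hk₀ ψ
  have e : ⌊(1 - δ (φ i)) * (((2 * k + 1 + 1 : ℕ) : ℝ)) ^ 2 / 2⌋₊ = y.val := by
    rw [← hnL]
    exact hφP i
  rw [e] at hfl'
  exact hfl' hψ hψ1

end Summit.HubbardSuperconductivity.HubbardSuperconductivity.Cruxes.CwThesis.Disproof.UniformFloor

namespace Summit.HubbardSuperconductivity.HubbardSuperconductivity.Cruxes.CwThesis.Disproof

open Literature.MathematicalPhysics.QuantumLattice Literature.Barriers.HubbardSuperconductivity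
open Literature.Probability.LatticeModels
open Filter Set Matrix
open scoped ComplexOrder
open _root_.Topology
open Summit.HubbardSuperconductivity.HubbardSuperconductivity.Theses.ChiralWindow (CwThesis)
open Summit.HubbardSuperconductivity.HubbardSuperconductivity.Theorems.SsbToEvenTorusLro.Negative
open Summit.HubbardSuperconductivity.WcbcsSsbToTorusLRO.Negative

/-! ### §0 The bridge to the catalogue's matrix -/

/-- `CwThesis` is, by `Iff.rfl`, the weak-coupling window statement over the barrier catalogue's matrix
`HasDWavePairFieldLROAt U δ` (which the route file inlines word for word). [folklore] -/
theorem cwThesis_iff :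
    CwThesis ↔ ∃ U₀ : ℝ, 0 < U₀ ∧ ∀ U ∈ Ioo (0:ℝ) U₀, ∃ δ ∈ Icc (3/10 : ℝ) (12/25),
      HasDWavePairFieldLROAt U δ :=
  Iff.rfl

/-! ### §1 Armour: what a disproof must exhibit -/

/-- **Negation through the quantifiers**: `¬X` iff for every `U₀ > 0` some `U ∈ (0, U₀)` has NO doping in
the window at which the summit matrix holds. [folklore] -/
theorem not_cwThesis_iff :
    ¬ CwThesis ↔ ∀ U₀ : ℝ, 0 < U₀ → ∃ U ∈ Ioo (0:ℝ) U₀, ∀ δ ∈ Icc (3/10 : ℝ) (12/25),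
      ¬ HasDWavePairFieldLROAt U δ := by
  rw [cwThesis_iff]
  push Not
  rfl

/-- **The armour.** A disproof of `CwThesis` exhibits, for arbitrarily small `U > 0` and EVERY `δ` of the
window, an admissible sequence (normalised `(N_L, S^z=0)`-sector ground states of `hubbardTorus 2 L 1 U`,
`N_L = 2⌊(1-δ)L²/2⌋`, at the even sides) WITHOUT `d_{x²-y²}` pair-field long-range order. [folklore] -/
theorem not_cwThesis_iff_exists_orderPoor :
    ¬ CwThesis ↔ ∀ U₀ : ℝ, 0 < U₀ → ∃ U ∈ Ioo (0:ℝ) U₀, ∀ δ ∈ Icc (3/10 : ℝ) (12/25),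
      ∃ (N : ℕ → ℕ) (ψ : ∀ L, Fock (Orb (FermionTorus 2 L))),
        (∀ L, Even L → N L = 2 * ⌊(1 - δ) * (L : ℝ) ^ 2 / 2⌋₊ ∧ star (ψ L) ⬝ᵥ ψ L = 1 ∧
            IsGroundStateInSector (hubbardTorus 2 L 1 U) (N L) 0 (ψ L)) ∧
          ¬ HasLongRangeOrder (fun k => halfOpenBox 2 (2 * k))
              (fun k => torusPullback (pairFieldCorr dWaveFormFactor ψ) (2 * k)) := by
  simp only [not_cwThesis_iff, not_hasDWavePairFieldLROAt_iff]

/-- **`X` is an eventual statement as `U → 0⁺`**: `X ↔ ∀ᶠ U in 𝓝[>] 0, ∃ δ ∈ window, matrix at (U, δ)`.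
In particular `X` is monotone in `U₀` and a refutation must bite FREQUENTLY along `U → 0⁺`. [folklore] -/
theorem cwThesis_iff_eventually :
    CwThesis ↔ ∀ᶠ U in 𝓝[>] (0:ℝ), ∃ δ ∈ Icc (3/10 : ℝ) (12/25), HasDWavePairFieldLROAt U δ := by
  rw [cwThesis_iff]
  constructor
  · rintro ⟨U₀, hU₀, h⟩
    filter_upwards [Ioo_mem_nhdsGT hU₀] with U hU using h U hU
  · intro h
    obtain ⟨U₀, hU₀mem, hU₀⟩ := mem_nhdsGT_iff_exists_Ioo_subset.1 h
    exact ⟨U₀, hU₀mem, fun U hU => hU₀ hU⟩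

/-- Negated eventual form: `¬X ↔ ∃ᶠ U in 𝓝[>] 0, ∀ δ ∈ window, ¬ matrix at (U, δ)`. [folklore] -/
theorem not_cwThesis_iff_frequently :
    ¬ CwThesis ↔ ∃ᶠ U in 𝓝[>] (0:ℝ), ∀ δ ∈ Icc (3/10 : ℝ) (12/25), ¬ HasDWavePairFieldLROAt U δ := by
  rw [cwThesis_iff_eventually, Filter.not_eventually]
  simp only [not_exists, not_and]

/-! ### §2 Quantifier order: `∀ U ∃ δ` versus `∃ δ ∀ U` -/

/-- **A fixed doping suffices**: a statement of the shape of `WeakCouplingBCS.WcbcsThesis` but with its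
doping inside the window (`∃ δ ∈ [3/10,12/25] ∃ U₀ > 0 ∀ U ∈ (0,U₀)`, matrix) implies `X`. (The converse is
not formal — see `forallExists_not_imp_existsForall`; and `WcbcsThesis` itself only places `δ` in
`(0, 1/2)`, so it does not formally imply `X` either.) [folklore] -/
theorem cwThesis_of_exists_forall
    (h : ∃ δ ∈ Icc (3/10 : ℝ) (12/25), ∃ U₀ : ℝ, 0 < U₀ ∧ ∀ U ∈ Ioo (0:ℝ) U₀,
      HasDWavePairFieldLROAt U δ) :
    CwThesis := by
  obtain ⟨δ, hδ, U₀, hU₀, h⟩ := h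
  exact ⟨U₀, hU₀, fun U hU => ⟨δ, hδ, h U hU⟩⟩

/-- **Abstract independence of the quantifier order.** For SOME matrix `M U δ` the `∀ U ∃ δ` form holds on
the window while the `∃ δ ∀ U` form fails (witness: `M U δ := δ = 3/10 + U/10`, a doping drifting with the
coupling, as the route's crossing line `δ*(U)` is allowed to). So nothing formal lets a prover of `X` fix
`δ` first, and nothing formal lets a refuter attack one `δ`. [folklore] -/
theorem forallExists_not_imp_existsForall :
    ∃ M : ℝ → ℝ → Prop,
      (∃ U₀ : ℝ, 0 < U₀ ∧ ∀ U ∈ Ioo (0:ℝ) U₀, ∃ δ ∈ Icc (3/10 : ℝ) (12/25), M U δ) ∧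
        ¬ (∃ δ ∈ Icc (3/10 : ℝ) (12/25), ∃ U₀ : ℝ, 0 < U₀ ∧ ∀ U ∈ Ioo (0:ℝ) U₀, M U δ) := by
  refine ⟨fun U δ => δ = 3/10 + U / 10, ⟨1, one_pos, fun U hU => ⟨3/10 + U / 10,
    ⟨by linarith [hU.1], by linarith [hU.2]⟩, rfl⟩⟩, ?_⟩
  rintro ⟨δ, -, U₀, hU₀, h⟩
  have h1 : δ = 3/10 + U₀ / 2 / 10 := h (U₀ / 2) ⟨by linarith, by linarith⟩
  have h2 : δ = 3/10 + U₀ / 4 / 10 := h (U₀ / 4) ⟨by linarith, by linarith⟩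
  linarith

/-! ### §3 The three admissibility clauses are load-bearing in thesis shape -/

/-- **`CwThesisWithoutGroundStateClause` is false**: drop "`ψ_L` is a sector ground state" (keep the number
clause and normalisation) and the thesis fails — the normalised vacuum sequence is admissible and has no pair
correlations (tree `not_matrix_without_groundStateClause`). [folklore] -/
theorem cwThesis_false_without_groundStateClause :
    ¬ ∃ U₀ : ℝ, 0 < U₀ ∧ ∀ U ∈ Ioo (0:ℝ) U₀, ∃ δ ∈ Icc (3/10 : ℝ) (12/25),
        ∀ (N : ℕ → ℕ) (ψ : ∀ L, Fock (Orb (FermionTorus 2 L))),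
          (∀ L, Even L → N L = 2 * ⌊(1 - δ) * (L : ℝ) ^ 2 / 2⌋₊ ∧ star (ψ L) ⬝ᵥ ψ L = 1) →
            HasLongRangeOrder (fun k => halfOpenBox 2 (2 * k))
              (fun k => torusPullback (pairFieldCorr dWaveFormFactor ψ) (2 * k)) := by
  rintro ⟨U₀, hU₀, h⟩
  obtain ⟨δ, -, hδ⟩ := h (U₀ / 2) ⟨by linarith, by linarith⟩
  exact not_matrix_without_groundStateClause δ hδ

/-- **`CwThesisWithoutNormalisation` is false**: drop `star ψ_L ⬝ᵥ ψ_L = 1` and the thesis fails at every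
`U` — rescaled ground states kill the `liminf` (tree `not_matrix_without_normalisation`, `δ ≥ -1`). [folklore] -/
theorem cwThesis_false_without_normalisation :
    ¬ ∃ U₀ : ℝ, 0 < U₀ ∧ ∀ U ∈ Ioo (0:ℝ) U₀, ∃ δ ∈ Icc (3/10 : ℝ) (12/25),
        ∀ (N : ℕ → ℕ) (ψ : ∀ L, Fock (Orb (FermionTorus 2 L))),
          (∀ L, Even L → N L = 2 * ⌊(1 - δ) * (L : ℝ) ^ 2 / 2⌋₊ ∧
              IsGroundStateInSector (hubbardTorus 2 L 1 U) (N L) 0 (ψ L)) →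
            HasLongRangeOrder (fun k => halfOpenBox 2 (2 * k))
              (fun k => torusPullback (pairFieldCorr dWaveFormFactor ψ) (2 * k)) := by
  rintro ⟨U₀, hU₀, h⟩
  obtain ⟨δ, hδ, h'⟩ := h (U₀ / 2) ⟨by linarith, by linarith⟩
  exact not_matrix_without_normalisation (U₀ / 2) (by linarith [hδ.1]) h'

/-- **`CwThesisWithoutNumberClause` is false**: drop `N_L = 2⌊(1-δ)L²/2⌋` and the thesis fails at every
`U` — the normalised ground states of the empty sector `(0, 0)` are admissible and order-free (tree
`not_matrix_without_numberClause`). [folklore] -/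
theorem cwThesis_false_without_numberClause :
    ¬ ∃ U₀ : ℝ, 0 < U₀ ∧ ∀ U ∈ Ioo (0:ℝ) U₀, ∃ _δ ∈ Icc (3/10 : ℝ) (12/25),
        ∀ (N : ℕ → ℕ) (ψ : ∀ L, Fock (Orb (FermionTorus 2 L))),
          (∀ L, Even L → star (ψ L) ⬝ᵥ ψ L = 1 ∧
              IsGroundStateInSector (hubbardTorus 2 L 1 U) (N L) 0 (ψ L)) →
            HasLongRangeOrder (fun k => halfOpenBox 2 (2 * k))
              (fun k => torusPullback (pairFieldCorr dWaveFormFactor ψ) (2 * k)) := by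
  rintro ⟨U₀, hU₀, h⟩
  obtain ⟨_, -, h'⟩ := h (U₀ / 2) ⟨by linarith, by linarith⟩
  exact not_matrix_without_numberClause (U₀ / 2) h'

/-! ### §4 The window's edges: vacuity below `δ = -1`, the empty band above `δ = 1` -/

/-- The number of orbitals of the fermionic `2 × 2` torus is `8`. [folklore] -/
theorem card_orb_fermionTorus_two_two : Fintype.card (Orb (FermionTorus 2 2)) = 8 := by
  rw [card_orb_fermionTorus_two]; norm_num

/-- **Vacuous truth below the band**: for `δ ≤ -3/2` the matrix `HasDWavePairFieldLROAt U δ` holds at EVERY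
`U`, for want of admissible sequences — at the even side `L = 2` the prescribed particle number
`N_2 = 2⌊2(1-δ)⌋ ≥ 10` exceeds the `8` orbitals of the `2 × 2` torus, so the sector `(N_2, 0)` is `⊥` and no
nonzero ground state exists there. [folklore] -/
theorem hasDWavePairFieldLROAt_of_le_neg_three_halves (U : ℝ) {δ : ℝ} (hδ : δ ≤ -3/2) :
    HasDWavePairFieldLROAt U δ := by
  intro N ψ hadm
  exfalso
  obtain ⟨hN, -, hGS⟩ := hadm 2 even_two
  have hfloor : 5 ≤ ⌊(1 - δ) * ((2:ℕ) : ℝ) ^ 2 / 2⌋₊ := Nat.le_floor (by push_cast; nlinarith)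
  have hN10 : 10 ≤ N 2 := by rw [hN]; omega
  have hmem : IsNParticle (N 2) (ψ 2) := ((mem_szSector_iff _ _ _).1 hGS.1).1
  apply hGS.2.1
  funext s
  refine hmem s (fun hs => ?_)
  have hle : s.card ≤ Fintype.card (Orb (FermionTorus 2 2)) := Finset.card_le_univ s
  rw [card_orb_fermionTorus_two_two] at hle
  omega

/-- **`CwThesisWithoutWindow` is trivially TRUE**: with the doping window replaced by `∃ δ : ℝ` the thesis is
provable by the vacuity above (`δ := -2`). The lower window edge (indeed any edge `> -1`) is what keeps `X`
honest: it is anti-vacuity bookkeeping before it is physics. [folklore] -/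
theorem cwThesisWithoutWindow_trivial :
    ∃ U₀ : ℝ, 0 < U₀ ∧ ∀ U ∈ Ioo (0:ℝ) U₀, ∃ δ : ℝ, HasDWavePairFieldLROAt U δ :=
  ⟨1, one_pos, fun U _ => ⟨-2, hasDWavePairFieldLROAt_of_le_neg_three_halves U (by norm_num)⟩⟩

/-- **The empty band is order-free**: for `δ ≥ 1` the prescribed particle number is `N_L = 0`; the
normalised ground states of the sector `(0, 0)` — multiples of the vacuum, which exist on every torus — form
an admissible sequence with identically vanishing pair correlations, so the matrix FAILS at every `U`.
[folklore] -/
theorem not_hasDWavePairFieldLROAt_of_one_le (U : ℝ) {δ : ℝ} (hδ : 1 ≤ δ) :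
    ¬ HasDWavePairFieldLROAt U δ := by
  intro h
  have hN : ∀ L : ℕ, 2 * ⌊(1 - δ) * (L : ℝ) ^ 2 / 2⌋₊ = 2 * 0 := fun L => by
    rw [Nat.floor_of_nonpos]
    have hL : (0:ℝ) ≤ (L : ℝ) ^ 2 := by positivity
    have : (1 - δ) * (L : ℝ) ^ 2 ≤ 0 := mul_nonpos_of_nonpos_of_nonneg (by linarith) hL
    linarith
  have key : ∀ L : ℕ, ∃ φ : Fock (Orb (FermionTorus 2 L)), star φ ⬝ᵥ φ = 1 ∧
      IsGroundStateInSector (hubbardTorus 2 L 1 U) (2 * 0) 0 φ :=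
    fun L => exists_unit_isGroundStateInSector_hubbardTorus U L 0 (Nat.zero_le _)
  choose φ hφ using key
  have hvac : ∀ L, φ L = φ L ∅ • (vacuum : Fock (Orb (FermionTorus 2 L))) := fun L =>
    eq_smul_vacuum_of_isNParticle_zero ((mem_szSector_iff _ _ _).1 (hφ L).2.1).1
  have hl := h (fun L => 2 * ⌊(1 - δ) * (L : ℝ) ^ 2 / 2⌋₊) φ
    fun L _ => ⟨rfl, (hφ L).1, by rw [hN]; exact (hφ L).2⟩
  have hzero : ∀ (k : ℕ) (x y : TorusSite 2 (2 * k)),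
      pairFieldCorr dWaveFormFactor φ (2 * k) x y = 0 := by
    intro k x y
    have e : φ = fun L => (φ L ∅) • (fun _ => (vacuum : Fock (Orb (FermionTorus 2 _)))) L :=
      funext fun L => hvac L
    rw [e, pairFieldCorr_smul, pairFieldCorr_vacuum, mul_zero]
  unfold HasLongRangeOrder at hl
  simp only [torusPullback_apply, hzero, Finset.sum_const_zero, zero_div, liminf_const] at hl
  exact lt_irrefl _ hl

/-- **`CwThesisAtEmptyBand` is false**: with the window replaced by (any subset of) `[1, ∞)` the thesis
fails. Together with `cwThesisWithoutWindow_trivial`: bookkeeping alone forces a window inside `(-1, 1)`;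
`Assembly` needs `⊆ (0, 1/2)`. [folklore] -/
theorem cwThesisAtEmptyBand_false :
    ¬ ∃ U₀ : ℝ, 0 < U₀ ∧ ∀ U ∈ Ioo (0:ℝ) U₀, ∃ δ ∈ Ici (1:ℝ), HasDWavePairFieldLROAt U δ := by
  rintro ⟨U₀, hU₀, h⟩
  obtain ⟨δ, hδ, hm⟩ := h (U₀ / 2) ⟨by linarith, by linarith⟩
  exact not_hasDWavePairFieldLROAt_of_one_le _ hδ hm

/-! ### §5 Normal form: a floor uniform over the ground space -/

/-- **`X` as a uniform floor.** `CwThesis` holds iff for all small `U > 0` there are a doping `δ_U` in the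
window and a constant `a(U) > 0` such that, at every large even side `L = 2k+2`, EVERY normalised ground state
`ψ` of `hubbardTorus 2 L 1 U` in the sector `(2⌊(1-δ_U)L²/2⌋, 0)` has pair intensity
`re⟨ψ, P†P ψ⟩ ≥ a(U)·L⁴` (`P = pairField dWaveFormFactor L = √2 Δ_d`; tree `hasDWavePairFieldLROAt_iff_floor`).
One order-poor ground state per large even side, at every `δ` of the window, refutes `X` at that `U`. [folklore] -/
theorem cwThesis_iff_floor :
    CwThesis ↔ ∃ U₀ : ℝ, 0 < U₀ ∧ ∀ U ∈ Ioo (0:ℝ) U₀, ∃ δ ∈ Icc (3/10 : ℝ) (12/25),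
      ∃ a : ℝ, 0 < a ∧ ∀ᶠ k : ℕ in atTop, ∀ ψ : Fock (Orb (FermionTorus 2 (2 * k + 1 + 1))),
        IsGroundStateInSector (hubbardTorus 2 (2 * k + 1 + 1) 1 U)
            (2 * ⌊(1 - δ) * (((2 * k + 1 + 1 : ℕ) : ℝ)) ^ 2 / 2⌋₊) 0 ψ →
          star ψ ⬝ᵥ ψ = 1 →
            a * ((2 * k + 1 + 1 : ℕ) : ℝ) ^ 4 ≤
              (expect ((pairField dWaveFormFactor (2 * k + 1 + 1))ᴴ *
                pairField dWaveFormFactor (2 * k + 1 + 1)) ψ).re := by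
  rw [cwThesis_iff]
  refine exists_congr fun U₀ => and_congr_right fun _ => forall₂_congr fun U _ =>
    exists_congr fun δ => and_congr_right fun hδ => ?_
  exact hasDWavePairFieldLROAt_iff_floor (by linarith [hδ.1])

/-! ### §6 The `U = 0` endpoint: `0 < U` is load-bearing (modulo the free bound, NEAR-MISS below) -/

/-- **No pair order at `U = 0`, given the free bound.** If every normalised sector ground state of the free
torus (`L ≥ 3`) has pair intensity at most `C·L²`, then the summit matrix FAILS at `U = 0` for every
`δ ≥ 0`: by the floor form a positive floor `a L⁴ ≤ C L²` would hold at every large even side (ground states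
exist in every admissible sector), absurd. [folklore] -/
theorem not_hasDWavePairFieldLROAt_zero_of_freeBound {C : ℝ}
    (hfree : ∀ (L : ℕ) [NeZero L], 3 ≤ L → ∀ (n : ℕ) (ψ : Fock (Orb (FermionTorus 2 L))),
      IsGroundStateInSector (hubbardTorus 2 L 1 0) (2 * n) 0 ψ → star ψ ⬝ᵥ ψ = 1 →
        (expect ((pairField dWaveFormFactor L)ᴴ * pairField dWaveFormFactor L) ψ).re ≤ C * (L : ℝ) ^ 2)
    {δ : ℝ} (hδ : 0 ≤ δ) : ¬ HasDWavePairFieldLROAt 0 δ := by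
  intro h
  obtain ⟨a, ha, hev⟩ := floor_of_hasDWavePairFieldLROAt hδ h
  -- eventually `a (2k+2)² ≤ C`, impossible
  obtain ⟨n, hn⟩ := exists_nat_gt (C / a)
  have hev2 : ∀ᶠ k : ℕ in atTop, n ≤ k ∧ 1 ≤ k := by
    filter_upwards [eventually_ge_atTop n, eventually_ge_atTop 1] with k h1 h2 using ⟨h1, h2⟩
  obtain ⟨k, hk, hnk, hk1⟩ := (hev.and hev2).exists
  set L : ℕ := 2 * k + 1 + 1 with hL
  haveI : NeZero L := ⟨by omega⟩
  have hL3 : 3 ≤ L := by omega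
  obtain ⟨ψ, hψ1, hψ⟩ := exists_unit_groundStateInSector L (0:ℝ)
    (halfFilling_floor_le_sq L hδ)
  have hlow := hk ψ hψ hψ1
  have hup := hfree L hL3 _ ψ hψ hψ1
  have hLpos : (0:ℝ) < (L : ℝ) ^ 2 := by positivity
  have hLge : (n : ℝ) + 1 ≤ (L : ℝ) := by
    have : n + 1 ≤ L := by omega
    exact_mod_cast this
  have h4 : ((L : ℕ) : ℝ) ^ 4 = (L : ℝ) ^ 2 * (L : ℝ) ^ 2 := by ring
  have key : a * (L : ℝ) ^ 2 ≤ C := by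
    have := hlow.trans hup
    rw [h4, ← mul_assoc] at this
    exact le_of_mul_le_mul_right this hLpos
  have hCa : C / a < (L : ℝ) ^ 2 := by
    calc C / a < n := hn
      _ ≤ (n : ℝ) + 1 := by linarith
      _ ≤ (L : ℝ) := hLge
      _ ≤ (L : ℝ) ^ 2 := by
          have h1 : (1:ℝ) ≤ (L:ℝ) := by
            have : 1 ≤ L := by omega
            exact_mod_cast this
          nlinarith
  rw [div_lt_iff₀ ha] at hCa
  linarith [mul_comm a ((L:ℝ)^2)]

/-- **`CwThesisFromZero` is false, given the free bound**: the variant of `X` with `U ∈ [0, U₀)` (the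
hypothesis `0 < U` dropped) fails, because at `U = 0` no doping of the window carries the matrix. Any proof
of `X` uses `U > 0` quantitatively; with §5, the floor `a(U, δ_U)` cannot be bounded below uniformly as
`U → 0⁺`. [folklore] -/
theorem cwThesis_false_from_zero_of_freeBound {C : ℝ}
    (hfree : ∀ (L : ℕ) [NeZero L], 3 ≤ L → ∀ (n : ℕ) (ψ : Fock (Orb (FermionTorus 2 L))),
      IsGroundStateInSector (hubbardTorus 2 L 1 0) (2 * n) 0 ψ → star ψ ⬝ᵥ ψ = 1 →
        (expect ((pairField dWaveFormFactor L)ᴴ * pairField dWaveFormFactor L) ψ).re ≤ C * (L : ℝ) ^ 2) :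
    ¬ ∃ U₀ : ℝ, 0 < U₀ ∧ ∀ U ∈ Ico (0:ℝ) U₀, ∃ δ ∈ Icc (3/10 : ℝ) (12/25),
        HasDWavePairFieldLROAt U δ := by
  rintro ⟨U₀, hU₀, h⟩
  obtain ⟨δ, hδ, hm⟩ := h 0 ⟨le_rfl, hU₀⟩
  exact not_hasDWavePairFieldLROAt_zero_of_freeBound hfree (by linarith [hδ.1]) hm

/-- **The free torus has no pair order in ANY sector ground state** (was the cycle-1 near-miss; now
`FreeEndpoint.free_pairIntensity_le`): for `L ≥ 3` and every normalised ground state `ψ` of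
`hubbardTorus 2 L 1 0` in a sector `(2n, S^z = 0)`, `re⟨ψ, P†P ψ⟩ ≤ 320 L²`. [folklore] -/
theorem free_pairIntensity_le (L : ℕ) [NeZero L] (hL : 3 ≤ L) (n : ℕ)
    (ψ : Fock (Orb (FermionTorus 2 L)))
    (hψ : IsGroundStateInSector (hubbardTorus 2 L 1 0) (2 * n) 0 ψ) (hψ1 : star ψ ⬝ᵥ ψ = 1) :
    (expect ((pairField dWaveFormFactor L)ᴴ * pairField dWaveFormFactor L) ψ).re ≤ 320 * (L : ℝ) ^ 2 :=
  FreeEndpoint.free_pairIntensity_le hL n ψ hψ hψ1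

/-- **The `U = 0` endpoint, UNCONDITIONAL**: the summit matrix fails at `U = 0` for every `δ ≥ 0`. [folklore] -/
theorem not_hasDWavePairFieldLROAt_zero {δ : ℝ} (hδ : 0 ≤ δ) : ¬ HasDWavePairFieldLROAt 0 δ :=
  not_hasDWavePairFieldLROAt_zero_of_freeBound (C := 320)
    (fun L _ hL n ψ hψ hψ1 => free_pairIntensity_le L hL n ψ hψ hψ1) hδ

/-- **`CwThesisFromZero` is false, UNCONDITIONALLY**: `0 < U` is load-bearing. [folklore] -/
theorem cwThesis_false_from_zero :
    ¬ ∃ U₀ : ℝ, 0 < U₀ ∧ ∀ U ∈ Ico (0:ℝ) U₀, ∃ δ ∈ Icc (3/10 : ℝ) (12/25),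
        HasDWavePairFieldLROAt U δ :=
  cwThesis_false_from_zero_of_freeBound (C := 320)
    (fun L _ hL n ψ hψ hψ1 => free_pairIntensity_le L hL n ψ hψ hψ1)


/-! ### §7 No `U`-uniform constants: the doubly-uniform strengthening of `X` is false (UNCONDITIONAL) -/

/-- **`CwThesisUniformFloor` is false.** There are no `U₀, a, k₀` such that for every `U ∈ (0, U₀)` some doping
`δ_U ∈ [3/10, 12/25]` carries the floor `a L⁴ ≤ re⟨ψ, P†P ψ⟩` for ALL normalised sector ground states at ALL even
sides `L = 2k+2`, `k ≥ k₀`: at a fixed large side, ground states along `U_j → 0` accumulate (compact unit sphere)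
at a ground state of the FREE torus in a sector that repeats infinitely often (pigeonhole), whose pair intensity
is `≤ 320 L² < a L⁴` (`FreeEndpoint.free_pairIntensity_le`, `UniformFloor.no_floor_along_vanishing_couplings`).
By `cwThesis_iff_floor`, `X` itself is exactly this statement with `a` and `k₀` allowed to depend on `U`: so the
constants of any proof of `X` must degenerate as `U → 0⁺`. [folklore] -/
theorem cwThesis_false_uniformFloor :
    ¬ ∃ U₀ a : ℝ, ∃ k₀ : ℕ, 0 < U₀ ∧ 0 < a ∧ ∀ U ∈ Ioo (0:ℝ) U₀, ∃ δ ∈ Icc (3/10 : ℝ) (12/25),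
        ∀ k : ℕ, k₀ ≤ k → ∀ ψ : Fock (Orb (FermionTorus 2 (2 * k + 1 + 1))),
          IsGroundStateInSector (hubbardTorus 2 (2 * k + 1 + 1) 1 U)
              (2 * ⌊(1 - δ) * (((2 * k + 1 + 1 : ℕ) : ℝ)) ^ 2 / 2⌋₊) 0 ψ →
            star ψ ⬝ᵥ ψ = 1 →
              a * ((2 * k + 1 + 1 : ℕ) : ℝ) ^ 4 ≤
                (expect ((pairField dWaveFormFactor (2 * k + 1 + 1))ᴴ *
                  pairField dWaveFormFactor (2 * k + 1 + 1)) ψ).re :=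
  UniformFloor.cwThesis_false_uniformFloor_of_freeBound (C := 320)
    (fun _ _ hL n ψ hψ hψ1 => FreeEndpoint.free_pairIntensity_le hL n ψ hψ hψ1)

end Summit.HubbardSuperconductivity.HubbardSuperconductivity.Cruxes.CwThesis.Disproof

end
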